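import Literature.NumberTheory.Sieve.PolymathSieveAsymptotics
import Mathlib
import HarnessLib

/-!
# Polymath 8b, §5.3: the analytic approximation step of Theorem 3.12(i) — proof of the named fact of `PolymathSieveAsymptotics.lean`

Trunk: AntSieve / parity.S13.  Third layer of the decomposition of
`Literature.NumberTheory.Sieve.frequently_nth_prime_succ_le_add_polymath` (`H₁ ≤ 246`, D. H. J. Polymath, *Variants of the
Selberg sieve, and bounded intervals containing many primes*, Res. Math. Sci. 1:12 (2014) =
arXiv:1407.4897, Theorem 1.4(i)).  `PolymathSieveAsymptotics.lean` reduces Theorem 3.12(i) to the sieve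
asymptotics Theorems 3.5(i)/3.6(i) and the purely real-analytic named fact
`exists_tensorCutoffs_of_polymathFunctional_gt` (§5.3 with §5.1, pp. 19–23: from a test function `F` on
`(1+ε)·R_k` with `(∑ᵢ J_{i,1-ε}(F))/I(F) > 2m/ϑ`, produce smooth one-variable cutoffs `f_{i,j}` with
`∑ᵢ S(f_{i,j}) < (1+ε)ϑ/2` and the key inequality `m α < β₁ + ⋯ + β_k` of Lemma 3.4).  This file PROVES
that fact: `exists_tensorCutoffs_of_polymathFunctional_gt_holds`.

## The construction (a quantitative version of pp. 19–23)

The printed proof truncates, rescales, translates and mollifies `F`, integrates to `f₃ = ∫_{s ≥ t} F₃`,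
approximates by tensor products via Stone–Weierstrass and finally partitions smoothly into pieces of
length `≤ δ₃`, bounding the error in `βᵢ` by "the supports of `f_{4,1}`, `f_{4,2}` only overlap on a
set of measure `O(δ₃)`" (p. 22).  We implement the same idea with an explicit smooth partition of unity,
which performs the Stone–Weierstrass and partition steps at once and keeps every bound explicit:

* `pouBump ζ(u) = ST(u+1) - ST(u)` (`ST = Real.smoothTransition`): smooth, `0 ≤ ζ ≤ 1`, supported in
  `[-1, 1]`, integer translates sum to `1` (`sum_pouBump_sub_intCast`); `pouTail Z(u) = ∫_u^1 ζ`.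
* `quasiInterp`: `G(x) = ∑_l F̃(δl) ∏ᵢ ζ(xᵢ/δ - lᵢ)` approximates a continuous `F̃` uniformly
  (`abs_quasiInterp_sub_le`); `F̃` is a continuous compactly supported `L²`-approximation of `F` cut
  off in the direction of `∑ yᵢ` (`exists_continuous_sq_approx`, from Mathlib's
  `MemLp.exists_hasCompactSupport_integral_rpow_sub_le`).  This replaces the truncation/mollification
  steps: all later errors are relative to `F` through `Δ = ∫ (G - F)²` only.
* The cutoffs are `f_{l,i}(t) = ρδ Z(t/(ρδ) - lᵢ)` (`pouCutoff`; smooth, `S(f_{l,i}) ≤ ρδ(lᵢ+1)`), at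
  the scale `ρ < ϑ/2` of p. 21 ("rescaling", here applied to the cutoffs rather than to `F`), indexed by
  `goodIndex` (multi-indices `l ≥ 0` with `∑ δ(lᵢ+1) ≤ S₀`).
* `tensorAlpha_pouCutoff`: `α = ρ^k ∫_{(0,1/ρ]^k} G²` ("`α` factorizes as `Ĩ(f₄)`", p. 21) and
  `tensorBeta_pouCutoff`: `β_{i₀} = ρ^{k+1} ∫ (Ψ₁ + 2Ψ₂) Ψ₁` with the marginals `Ψ_S` of the partial
  sums over `𝒥₁`, `𝒥₂` (p. 22), by Fubini for product integrands (`integral_fintype_prod_eq_prod`).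
* `beta_integrand_lower_bound` + `volume_shell_le`: `(Ψ₁ + 2Ψ₂)Ψ₁ ≥ 𝟙_A (M⁺G)² - 8B² 𝟙_shell` and
  the shell `{Λ - 2(k-1)δ < ∑_{i≠i₀} xᵢ < Λ}` has volume `≤ 2(k-1)δ R^{k-1}` (volume through fibres,
  `measurePreserving_piFinSuccAbove`) — the "`O(δ₃)` overlap" of p. 22.
* `marginal_sq_bound`: `∫_Q (M⁺F)² ≤ (1+τ) ∫_Q (M⁺G)² + (1+1/τ)·4Δ` ("by continuity", p. 20), from
  a.e. integrability of sections (`ae_integrable_section`), Jensen in the `u`-variable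
  (`sq_setIntegral_abs_le`) and Fubini along `i₀` (`lintegral_betaBox_section`).
* `alpha_le`, `beta_ge`, and the assembly `exists_tensorCutoffs_of_polymathFunctional_gt_holds`, which
  chooses `ρ, κ, τ', τ, η, F̃, δ, L` in this order so that the four error terms are each `≤ g/5`,
  `g = ρ ∑ᵢ Jᵢ(F) - m I(F) > 0`, and reindexes the finite index set by `Fin n` (`exists_fin_reindex`).

All statements are over `Fin k → ℝ` with the conventions of `PolymathBoundedGaps.lean` (`polymathI`,
`polymathJ`, `polymathJRegion`, `IsPolymathTestFunction`) and `PolymathSieveAsymptotics.lean`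
(`IsSieveCutoff`, `tensorAlpha`, `tensorBeta`).  No number theory is involved.

## References

* D. H. J. Polymath, *Variants of the Selberg sieve, and bounded intervals containing many primes*,
  Res. Math. Sci. 1 (2014), Art. 12; arXiv:1407.4897, §5.1 (pp. 19–21) and §5.3 (pp. 21–23).
  [Polymath8b2014]
-/

noncomputable section

open MeasureTheory Filter Finset Asymptotics Real
open scoped BigOperators Topology ContDiff

namespace Literature.NumberTheory.Sieve


/-! ### A smooth partition of unity on `ℝ` by translates of one bump -/

/-- `ζ(u) := ST(u + 1) - ST(u)` with `ST = Real.smoothTransition`: a smooth bump, `0 ≤ ζ ≤ 1`,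
supported in `[-1, 1]`, whose integer translates sum to `1`. [folklore] -/
def pouBump (u : ℝ) : ℝ := smoothTransition (u + 1) - smoothTransition u

/-- `ζ` is smooth. [folklore] -/
theorem pouBump_contDiff {n : ℕ∞} : ContDiff ℝ n pouBump :=
  (smoothTransition.contDiff.comp (contDiff_id.add contDiff_const)).sub smoothTransition.contDiff

/-- `ζ` is continuous. [folklore] -/
theorem pouBump_continuous : Continuous pouBump :=
  (pouBump_contDiff (n := 0)).continuous

/-- `ζ ≥ 0` (monotonicity of `smoothTransition`). [folklore] -/
theorem pouBump_nonneg (u : ℝ) : 0 ≤ pouBump u :=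
  sub_nonneg.2 (smoothTransition.monotone (by linarith))

/-- `ζ ≤ 1`. [folklore] -/
theorem pouBump_le_one (u : ℝ) : pouBump u ≤ 1 := by
  have h1 := smoothTransition.le_one (u + 1)
  have h2 := smoothTransition.nonneg u
  unfold pouBump; linarith

/-- `ζ(u) = 0` for `u ≥ 1`. [folklore] -/
theorem pouBump_of_one_le {u : ℝ} (hu : 1 ≤ u) : pouBump u = 0 := by
  rw [pouBump, smoothTransition.one_of_one_le (by linarith), smoothTransition.one_of_one_le hu,
    sub_self]

/-- `ζ(u) = 0` for `u ≤ -1`. [folklore] -/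
theorem pouBump_of_le_neg_one {u : ℝ} (hu : u ≤ -1) : pouBump u = 0 := by
  rw [pouBump, smoothTransition.zero_of_nonpos (by linarith),
    smoothTransition.zero_of_nonpos (by linarith), sub_self]

/-- Telescoping: `∑_{l=-L}^{L} ζ(v - l) = 1` for `-L ≤ v ≤ L`. [folklore] -/
theorem sum_pouBump_sub_intCast {L : ℕ} {v : ℝ} (hv1 : -(L : ℝ) ≤ v) (hv2 : v ≤ L) :
    ∑ l ∈ Finset.Icc (-(L : ℤ)) L, pouBump (v - l) = 1 := by
  -- reindex l = m - L with m ∈ range (2L+1)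
  have key : ∀ N : ℕ, ∑ m ∈ Finset.range N, pouBump (v + L - m) =
      smoothTransition (v + L + 1) - smoothTransition (v + L + 1 - N) := by
    intro N
    induction N with
    | zero => simp
    | succ N ih =>
      rw [Finset.sum_range_succ, ih, pouBump]
      push_cast
      ring_nf
  have hre : ∑ l ∈ Finset.Icc (-(L : ℤ)) L, pouBump (v - l) =
      ∑ m ∈ Finset.range (2 * L + 1), pouBump (v + L - m) := by
    refine Finset.sum_nbij' (fun l => (l + L).toNat) (fun m => (m : ℤ) - L) ?_ ?_ ?_ ?_ ?_
    · intro l hl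
      rw [Finset.mem_Icc] at hl
      rw [Finset.mem_range]
      omega
    · intro m hm
      rw [Finset.mem_range] at hm
      rw [Finset.mem_Icc]
      omega
    · intro l hl
      rw [Finset.mem_Icc] at hl
      omega
    · intro m hm
      simp
    · intro l hl
      rw [Finset.mem_Icc] at hl
      congr 1
      have : (((l + L).toNat : ℕ) : ℝ) = (l : ℝ) + L := by
        have h0 : 0 ≤ l + L := by omega
        exact_mod_cast Int.toNat_of_nonneg h0
      rw [this]; ring
  rw [hre, key, smoothTransition.one_of_one_le (by linarith),
    smoothTransition.zero_of_nonpos (by push_cast; linarith), sub_zero]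

/-- The tail integral `Z(u) := ∫_u^1 ζ` (`= ∫_u^∞ ζ`, as `ζ` vanishes on `[1, ∞)`). [folklore] -/
def pouTail (u : ℝ) : ℝ := ∫ v in u..1, pouBump v

/-- `Z' = -ζ` (fundamental theorem of calculus). [folklore] -/
theorem hasDerivAt_pouTail (u : ℝ) : HasDerivAt pouTail (-pouBump u) u :=
  intervalIntegral.integral_hasDerivAt_left (pouBump_continuous.intervalIntegrable _ _)
    (pouBump_continuous.stronglyMeasurableAtFilter _ _) pouBump_continuous.continuousAt

/-- `deriv Z = -ζ`. [folklore] -/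
theorem deriv_pouTail : deriv pouTail = fun u => -pouBump u :=
  funext fun u => (hasDerivAt_pouTail u).deriv

/-- `Z` is differentiable. [folklore] -/
theorem differentiable_pouTail : Differentiable ℝ pouTail := fun u =>
  (hasDerivAt_pouTail u).differentiableAt

/-- `Z` is smooth (its derivative `-ζ` is). [folklore] -/
theorem pouTail_contDiff : ContDiff ℝ ∞ pouTail := by
  rw [contDiff_infty]
  intro n
  induction n with
  | zero => exact contDiff_zero.2 differentiable_pouTail.continuous
  | succ n ih =>
    rw [Nat.cast_add, Nat.cast_one, contDiff_succ_iff_deriv]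
    refine ⟨differentiable_pouTail, fun h => ?_, ?_⟩
    · exact absurd h (by simp)
    · rw [deriv_pouTail]
      exact (pouBump_contDiff (n := n)).neg

/-- `Z(u) = 0` for `u ≥ 1`. [folklore] -/
theorem pouTail_of_one_le {u : ℝ} (hu : 1 ≤ u) : pouTail u = 0 := by
  rw [pouTail, intervalIntegral.integral_symm, neg_eq_zero]
  refine intervalIntegral.integral_zero_ae (ae_of_all _ fun v hv => ?_)
  rw [Set.uIoc_of_le hu] at hv
  exact pouBump_of_one_le hv.1.le

/-! ### The `k`-dimensional partition of unity and the quasi-interpolant -/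

section MultiDim

variable {k : ℕ}

/-- The index box `{-L, …, L}^k`. [folklore] -/
def indexBox (k L : ℕ) : Finset (Fin k → ℤ) :=
  Fintype.piFinset fun _ => Finset.Icc (-(L : ℤ)) L

/-- The tensor bump attached to the multi-index `l` at scale `δ`: `∏ᵢ ζ(xᵢ/δ - lᵢ)`. [cite: Polymath8b2014, §5.3, pp. 21–23] -/
def tensorBump (δ : ℝ) (l : Fin k → ℤ) (x : Fin k → ℝ) : ℝ :=
  ∏ i, pouBump (x i / δ - l i)

/-- Tensor bumps are nonnegative. [folklore] -/
theorem tensorBump_nonneg (δ : ℝ) (l : Fin k → ℤ) (x : Fin k → ℝ) : 0 ≤ tensorBump δ l x :=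
  Finset.prod_nonneg fun _ _ => pouBump_nonneg _

/-- `∑_{l ∈ box} ∏ᵢ ζ(xᵢ/δ - lᵢ) = 1` when `|xᵢ/δ| ≤ L` for all `i`. [folklore] -/
theorem sum_tensorBump_eq_one {δ : ℝ} {L : ℕ} {x : Fin k → ℝ}
    (hx : ∀ i, -(L : ℝ) ≤ x i / δ ∧ x i / δ ≤ L) :
    ∑ l ∈ indexBox k L, tensorBump δ l x = 1 := by
  unfold indexBox tensorBump
  rw [← Finset.prod_univ_sum (fun _ => Finset.Icc (-(L : ℤ)) L) fun i (m : ℤ) => pouBump (x i / δ - m)]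
  exact Finset.prod_eq_one fun i _ => sum_pouBump_sub_intCast (hx i).1 (hx i).2

/-- A tensor bump vanishes unless `|xᵢ/δ - lᵢ| < 1` for every `i`. [folklore] -/
theorem tensorBump_eq_zero {δ : ℝ} {l : Fin k → ℤ} {x : Fin k → ℝ} {i : Fin k}
    (h : 1 ≤ |x i / δ - l i|) : tensorBump δ l x = 0 := by
  unfold tensorBump
  refine Finset.prod_eq_zero (Finset.mem_univ i) ?_
  rcases le_abs'.1 h with h | h
  · exact pouBump_of_le_neg_one (by linarith)
  · exact pouBump_of_one_le h

/-- The quasi-interpolant `G(x) := ∑_{l ∈ box} Φ(δ l) ∏ᵢ ζ(xᵢ/δ - lᵢ)` of a function `Φ`. [cite: Polymath8b2014, §5.3, pp. 21–23] -/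
def quasiInterp (δ : ℝ) (L : ℕ) (Φ : (Fin k → ℝ) → ℝ) (x : Fin k → ℝ) : ℝ :=
  ∑ l ∈ indexBox k L, Φ (fun i => δ * l i) * tensorBump δ l x

/-- Pointwise error of the quasi-interpolant inside the box: if `|Φ(y) - Φ(x)| ≤ ω` whenever
`|yᵢ - xᵢ| ≤ δ` for all `i`, then `|G(x) - Φ(x)| ≤ ω`. [cite: Polymath8b2014, §5.3, pp. 21–23] -/
theorem abs_quasiInterp_sub_le {δ : ℝ} (hδ : 0 < δ) {L : ℕ} {Φ : (Fin k → ℝ) → ℝ}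
    {x : Fin k → ℝ} (hx : ∀ i, -(L : ℝ) ≤ x i / δ ∧ x i / δ ≤ L) {w : ℝ}
    (hω : ∀ y : Fin k → ℝ, (∀ i, |y i - x i| ≤ δ) → |Φ y - Φ x| ≤ w) :
    |quasiInterp δ L Φ x - Φ x| ≤ w := by
  have h1 := sum_tensorBump_eq_one hx
  have hrepr : quasiInterp δ L Φ x - Φ x =
      ∑ l ∈ indexBox k L, (Φ (fun i => δ * l i) - Φ x) * tensorBump δ l x := by
    simp only [sub_mul, Finset.sum_sub_distrib, ← Finset.mul_sum, h1, mul_one, quasiInterp]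
  rw [hrepr]
  refine (Finset.abs_sum_le_sum_abs _ _).trans ?_
  calc ∑ l ∈ indexBox k L, |(Φ (fun i => δ * l i) - Φ x) * tensorBump δ l x|
      ≤ ∑ l ∈ indexBox k L, w * tensorBump δ l x := Finset.sum_le_sum fun l _ => by
        rw [abs_mul, abs_of_nonneg (tensorBump_nonneg δ l x)]
        by_cases hl : ∀ i, |x i / δ - l i| < 1
        · refine mul_le_mul_of_nonneg_right (hω _ fun i => ?_) (tensorBump_nonneg δ l x)
          have := hl i
          rw [abs_lt] at this
          rw [abs_le]
          constructor
          · have h2 : x i / δ - l i < 1 := this.2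
            rw [div_sub' (hδ.ne'), div_lt_one hδ] at h2
            linarith
          · have h2 : -1 < x i / δ - l i := this.1
            rw [div_sub' (hδ.ne'), lt_div_iff₀ hδ] at h2
            linarith
        · push Not at hl
          obtain ⟨i, hi⟩ := hl
          rw [tensorBump_eq_zero hi, mul_zero, mul_zero]
    _ = w := by rw [← Finset.mul_sum, h1, mul_one]

end MultiDim



/-! ### The cutoff family `f_{l,i}(t) = ρδ · Z(t/(ρδ) - lᵢ)` -/

section Family

variable {k : ℕ}

/-- The cutoff attached to the multi-index `l` and the coordinate `i` at scales `ρ`, `δ`. [cite: Polymath8b2014, §5.3, pp. 21–23] -/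
def pouCutoff (ρ δ : ℝ) (l : Fin k → ℤ) (i : Fin k) : ℝ → ℝ :=
  fun t => ρ * δ * pouTail (t / (ρ * δ) - l i)

/-- The cutoffs `f_{l,i}` are sieve cutoffs with `S(f_{l,i}) ≤ ρδ(lᵢ + 1)` (smooth, vanishing beyond); Polymath 8b p. 22: "smooth functions supported on intervals of length at most `δ₃`". [cite: Polymath8b2014, §5.3, pp. 21–23] -/
theorem pouCutoff_isSieveCutoff {ρ δ : ℝ} (hρ : 0 < ρ) (hδ : 0 < δ) (l : Fin k → ℤ) (i : Fin k)
    (hl : -1 ≤ l i) : IsSieveCutoff (pouCutoff ρ δ l i) (ρ * δ * (l i + 1)) where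
  contDiff := contDiff_const.mul
    (pouTail_contDiff.comp ((contDiff_id.div_const _).sub contDiff_const))
  nonneg := by
    have : (0 : ℝ) ≤ (l i : ℝ) + 1 := by exact_mod_cast (by omega : (0 : ℤ) ≤ l i + 1)
    positivity
  eq_zero t ht := by
    have hρδ : 0 < ρ * δ := mul_pos hρ hδ
    simp only [pouCutoff]
    rw [pouTail_of_one_le, mul_zero]
    rw [le_sub_iff_add_le, le_div_iff₀ hρδ]
    linarith

/-- `f'_{l,i}(t) = -ζ(t/(ρδ) - lᵢ)` (chain rule). [folklore] -/
theorem hasDerivAt_pouCutoff {ρ δ : ℝ} (hρδ : ρ * δ ≠ 0) (l : Fin k → ℤ) (i : Fin k) (t : ℝ) :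
    HasDerivAt (pouCutoff ρ δ l i) (-pouBump (t / (ρ * δ) - l i)) t := by
  have h1 : HasDerivAt (fun t => t / (ρ * δ) - (l i : ℝ)) (1 / (ρ * δ)) t := by
    simpa using (hasDerivAt_id t).div_const (ρ * δ) |>.sub_const (l i : ℝ)
  have h2 := ((hasDerivAt_pouTail _).comp t h1).const_mul (ρ * δ)
  refine h2.congr_deriv ?_
  rw [mul_comm (-pouBump _) _, ← mul_assoc, mul_one_div_cancel hρδ, one_mul]

/-- `deriv f_{l,i} = -ζ(·/(ρδ) - lᵢ)`. [folklore] -/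
theorem deriv_pouCutoff {ρ δ : ℝ} (hρδ : ρ * δ ≠ 0) (l : Fin k → ℤ) (i : Fin k) :
    deriv (pouCutoff ρ δ l i) = fun t => -pouBump (t / (ρ * δ) - l i) :=
  funext fun t => (hasDerivAt_pouCutoff hρδ l i t).deriv

/-- `f_{l,i}(0) = ρδ Z(-lᵢ)`. [folklore] -/
theorem pouCutoff_zero (ρ δ : ℝ) (l : Fin k → ℤ) (i : Fin k) :
    pouCutoff ρ δ l i 0 = ρ * δ * pouTail (-(l i : ℝ)) := by
  simp [pouCutoff]

/-- The scale-`1` bump in coordinate `i`: `ζ(x/δ - lᵢ)`; it vanishes for `x ≥ δ(lᵢ + 1)` and for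
`x ≤ δ (lᵢ - 1)`. [folklore] -/
theorem pouBump_div_sub_eq_zero_of_le {δ : ℝ} (hδ : 0 < δ) {l : ℤ} {x : ℝ}
    (hx : δ * (l + 1) ≤ x) : pouBump (x / δ - l) = 0 :=
  pouBump_of_one_le (by rw [le_sub_iff_add_le, le_div_iff₀ hδ]; linarith)

/-- `ζ(x/δ - l) = 0` for `x ≤ δ(l - 1)`. [folklore] -/
theorem pouBump_div_sub_eq_zero_of_ge {δ : ℝ} (hδ : 0 < δ) {l : ℤ} {x : ℝ}
    (hx : x ≤ δ * (l - 1)) : pouBump (x / δ - l) = 0 :=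
  pouBump_of_le_neg_one (by rw [sub_le_iff_le_add, div_le_iff₀ hδ]; linarith)

/-- `∫₀¹ f'_{l,i} f'_{l',i} = ρ ∫₀^{1/ρ} ζ(x/δ - lᵢ) ζ(x/δ - l'ᵢ) dx`. [cite: Polymath8b2014, §5.3, pp. 21–23] -/
theorem integral_deriv_pouCutoff_mul {ρ δ : ℝ} (hρ : 0 < ρ) (hδ : 0 < δ) (l l' : Fin k → ℤ)
    (i : Fin k) :
    ∫ t in (0 : ℝ)..1, deriv (pouCutoff ρ δ l i) t * deriv (pouCutoff ρ δ l' i) t =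
      ρ * ∫ x in (0 : ℝ)..1 / ρ, pouBump (x / δ - l i) * pouBump (x / δ - l' i) := by
  have hρδ : ρ * δ ≠ 0 := (mul_pos hρ hδ).ne'
  simp only [deriv_pouCutoff hρδ, neg_mul_neg]
  have h := intervalIntegral.integral_comp_div
    (fun x => pouBump (x / δ - l i) * pouBump (x / δ - l' i)) (a := 0) (b := 1) hρ.ne'
  simp only [zero_div, smul_eq_mul] at h
  rw [← h]
  refine intervalIntegral.integral_congr fun t _ => ?_
  simp only [div_div, mul_comm ρ δ]

/-- `f_{l,i}(0) = ρ ∫₀^{1/ρ} ζ(u/δ - lᵢ) du` when `δ(lᵢ + 1) ≤ 1/ρ`. [cite: Polymath8b2014, §5.3, pp. 21–23] -/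
theorem pouCutoff_zero_eq_integral {ρ δ : ℝ} (hδ : 0 < δ) (l : Fin k → ℤ) (i : Fin k)
    (hli : δ * (l i + 1) ≤ 1 / ρ) :
    pouCutoff ρ δ l i 0 = ρ * ∫ u in (0 : ℝ)..1 / ρ, pouBump (u / δ - l i) := by
  rw [pouCutoff_zero, intervalIntegral.integral_comp_div_sub _ hδ.ne', zero_div, zero_sub,
    smul_eq_mul, pouTail, mul_assoc]
  congr 1
  -- `∫_{-lᵢ}^{1} ζ = ∫_{-lᵢ}^{1/(ρδ) - lᵢ} ζ` as `ζ = 0` on `[1, ∞)`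
  have hc : Continuous pouBump := pouBump_continuous
  have h1 : (1 : ℝ) ≤ 1 / ρ / δ - l i := by
    rw [le_sub_iff_add_le, le_div_iff₀ hδ]; linarith
  have hsplit : ∫ x in (-(l i : ℝ))..1 / ρ / δ - l i, pouBump x =
      (∫ x in (-(l i : ℝ))..1, pouBump x) + ∫ x in (1 : ℝ)..1 / ρ / δ - l i, pouBump x :=
    (intervalIntegral.integral_add_adjacent_intervals (hc.intervalIntegrable _ _)
      (hc.intervalIntegrable _ _)).symm
  have h0 : ∫ x in (1 : ℝ)..1 / ρ / δ - l i, pouBump x = 0 :=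
    intervalIntegral.integral_zero_ae (ae_of_all _ fun v hv => by
      rw [Set.uIoc_of_le h1] at hv
      exact pouBump_of_one_le hv.1.le)
  rw [hsplit, h0, add_zero]

end Family


/-! ### `α` as an `L²` norm on the box `(0, 1/ρ]^k` -/

section AlphaBox

variable {k : ℕ}

/-- The box `(0, R]^k`. [folklore] -/
def ioBox (k : ℕ) (R : ℝ) : Set (Fin k → ℝ) := Set.pi Set.univ fun _ => Set.Ioc 0 R

/-- `(0, R]^k ⊆ [0, R]^k`. [folklore] -/
theorem ioBox_subset_Icc (R : ℝ) : ioBox k R ⊆ Set.Icc (0 : Fin k → ℝ) (fun _ => R) := by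
  rw [← Set.pi_univ_Icc]
  exact Set.pi_mono fun i _ => Set.Ioc_subset_Icc_self

/-- The box `(0, R]^k` is measurable. [folklore] -/
theorem measurableSet_ioBox (R : ℝ) : MeasurableSet (ioBox k R) :=
  MeasurableSet.univ_pi fun _ => measurableSet_Ioc

/-- Lebesgue measure restricted to `(0, R]^k` is the product of the restrictions. [folklore] -/
theorem volume_restrict_ioBox (R : ℝ) :
    (volume : Measure (Fin k → ℝ)).restrict (ioBox k R) =
      Measure.pi fun _ => (volume : Measure ℝ).restrict (Set.Ioc 0 R) := by
  rw [volume_pi, ioBox, Measure.restrict_pi_pi]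

/-- `∏ᵢ ∫_{(0,R]} φᵢ = ∫_{(0,R]^k} ∏ᵢ φᵢ(xᵢ)` (Fubini for products). [folklore] -/
theorem prod_integral_Ioc_eq_integral_ioBox (R : ℝ) (φ : Fin k → ℝ → ℝ) :
    ∏ i, ∫ x in Set.Ioc 0 R, φ i x = ∫ x in ioBox k R, ∏ i, φ i (x i) := by
  rw [volume_restrict_ioBox (k := k) R]
  exact (integral_fintype_prod_eq_prod (fun i => φ i)).symm

/-- Tensor bumps are continuous. [folklore] -/
theorem tensorBump_continuous (δ : ℝ) (l : Fin k → ℤ) : Continuous (tensorBump δ l) :=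
  continuous_finsetProd _ fun i _ =>
    pouBump_continuous.comp (by fun_prop : Continuous fun a : Fin k → ℝ => a i / δ - (l i : ℝ))

/-- The scale-`1` tensor sum `G(x) = ∑_{l ∈ J} c_l ∏ᵢ ζ(xᵢ/δ - lᵢ)`. [cite: Polymath8b2014, §5.3, pp. 21–23] -/
def tensorSum (δ : ℝ) (J : Finset (Fin k → ℤ)) (c : (Fin k → ℤ) → ℝ) (x : Fin k → ℝ) : ℝ :=
  ∑ l ∈ J, c l * tensorBump δ l x

/-- Tensor sums are continuous. [folklore] -/
theorem tensorSum_continuous (δ : ℝ) (J : Finset (Fin k → ℤ)) (c : (Fin k → ℤ) → ℝ) :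
    Continuous (tensorSum δ J c) :=
  continuous_finsetSum _ fun l _ => continuous_const.mul (tensorBump_continuous δ l)

/-- Continuous functions are integrable on the bounded box `(0, R]^k`. [folklore] -/
theorem integrableOn_ioBox_of_continuous {φ : (Fin k → ℝ) → ℝ} (hφ : Continuous φ) (R : ℝ) :
    IntegrableOn φ (ioBox k R) :=
  (hφ.integrableOn_Icc (a := (0 : Fin k → ℝ)) (b := fun _ => R)).mono_set (ioBox_subset_Icc R)

/-- **`α = ρ^k ‖G‖²_{L²((0,1/ρ]^k)}`** for the cutoff family `f_{l,i}`. [cite: Polymath8b2014, §5.3, pp. 21–23] -/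
theorem tensorAlpha_pouCutoff {ρ δ : ℝ} (hρ : 0 < ρ) (hδ : 0 < δ) (J : Finset (Fin k → ℤ))
    (c : (Fin k → ℤ) → ℝ) :
    tensorAlpha J c (fun i l => pouCutoff ρ δ l i) =
      ρ ^ k * ∫ x in ioBox k (1 / ρ), tensorSum δ J c x ^ 2 := by
  have hR : (0 : ℝ) ≤ 1 / ρ := by positivity
  -- each pair `(l, l')`
  have hpair : ∀ l l' : Fin k → ℤ,
      ∏ i, ∫ t in (0 : ℝ)..1, deriv (pouCutoff ρ δ l i) t * deriv (pouCutoff ρ δ l' i) t =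
        ρ ^ k * ∫ x in ioBox k (1 / ρ), tensorBump δ l x * tensorBump δ l' x := by
    intro l l'
    simp_rw [integral_deriv_pouCutoff_mul hρ hδ, intervalIntegral.integral_of_le hR,
      Finset.prod_mul_distrib, Finset.prod_const, Finset.card_univ, Fintype.card_fin]
    congr 1
    rw [prod_integral_Ioc_eq_integral_ioBox]
    refine setIntegral_congr_fun (measurableSet_ioBox _) fun x _ => ?_
    simp only [tensorBump, ← Finset.prod_mul_distrib]
  have hint : ∀ l l' : Fin k → ℤ, IntegrableOn
      (fun x => c l * c l' * (tensorBump δ l x * tensorBump δ l' x)) (ioBox k (1 / ρ)) :=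
    fun l l' => integrableOn_ioBox_of_continuous (continuous_const.mul
      ((tensorBump_continuous δ l).mul (tensorBump_continuous δ l'))) _
  unfold tensorAlpha
  simp_rw [hpair]
  calc ∑ j ∈ J, ∑ j' ∈ J, c j * c j' *
        (ρ ^ k * ∫ x in ioBox k (1 / ρ), tensorBump δ j x * tensorBump δ j' x)
      = ρ ^ k * ∑ j ∈ J, ∑ j' ∈ J,
          ∫ x in ioBox k (1 / ρ), c j * c j' * (tensorBump δ j x * tensorBump δ j' x) := by
        rw [Finset.mul_sum]
        refine Finset.sum_congr rfl fun j _ => ?_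
        rw [Finset.mul_sum]
        refine Finset.sum_congr rfl fun j' _ => ?_
        rw [integral_const_mul]
        ring
    _ = ρ ^ k * ∫ x in ioBox k (1 / ρ), ∑ j ∈ J, ∑ j' ∈ J,
          c j * c j' * (tensorBump δ j x * tensorBump δ j' x) := by
        congr 1
        rw [integral_finsetSum _ fun j _ => integrable_finsetSum _ fun j' _ => hint j j']
        refine Finset.sum_congr rfl fun j _ => ?_
        rw [integral_finsetSum _ fun j' _ => hint j j']
    _ = ρ ^ k * ∫ x in ioBox k (1 / ρ), tensorSum δ J c x ^ 2 := by
        congr 1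
        refine setIntegral_congr_fun (measurableSet_ioBox _) fun x _ => ?_
        simp only [tensorSum, sq, Finset.sum_mul_sum]
        refine Finset.sum_congr rfl fun j _ => Finset.sum_congr rfl fun j' _ => ?_
        ring

end AlphaBox


/-! ### `β_{i₀}` as an integral over the box `(0,1] × (0,1/ρ]^{k-1}` -/

section BetaBox

variable {k : ℕ}

/-- `∏ᵢ ∫_{sᵢ} φᵢ = ∫_{∏ sᵢ} ∏ᵢ φᵢ(xᵢ)` (Fubini for products over a product set). [folklore] -/
theorem prod_setIntegral_eq_integral_pi (s : Fin k → Set ℝ) (φ : Fin k → ℝ → ℝ) :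
    ∏ i, ∫ x in s i, φ i x = ∫ x in Set.pi Set.univ s, ∏ i, φ i (x i) := by
  have : (volume : Measure (Fin k → ℝ)).restrict (Set.pi Set.univ s) =
      Measure.pi fun i => (volume : Measure ℝ).restrict (s i) := by
    rw [volume_pi, Measure.restrict_pi_pi]
  rw [this]
  exact (integral_fintype_prod_eq_prod (fun i => φ i)).symm

/-- The box `(0, 1] × (0, R]^{k-1}` (the `i₀`-th side is `(0, 1]`). [cite: Polymath8b2014, §5.3, pp. 21–23] -/
def betaBox (k : ℕ) (R : ℝ) (i₀ : Fin k) : Set (Fin k → ℝ) :=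
  Set.pi Set.univ fun i => if i = i₀ then Set.Ioc 0 1 else Set.Ioc 0 R

/-- `betaBox` is measurable. [folklore] -/
theorem measurableSet_betaBox (R : ℝ) (i₀ : Fin k) : MeasurableSet (betaBox k R i₀) :=
  MeasurableSet.univ_pi fun i => by
    by_cases hi : i = i₀
    · simp only [hi, ↓reduceIte]; exact measurableSet_Ioc
    · simp only [hi, ↓reduceIte]; exact measurableSet_Ioc

/-- `betaBox ⊆ [0, R]^k` for `R ≥ 1`. [folklore] -/
theorem betaBox_subset_Icc {R : ℝ} (hR : 1 ≤ R) (i₀ : Fin k) :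
    betaBox k R i₀ ⊆ Set.Icc (0 : Fin k → ℝ) (fun _ => R) := by
  rw [← Set.pi_univ_Icc]
  refine Set.pi_mono fun i _ => ?_
  by_cases hi : i = i₀
  · simp only [hi, ↓reduceIte]
    exact Set.Ioc_subset_Icc_self.trans (Set.Icc_subset_Icc_right hR)
  · simp only [hi, ↓reduceIte]
    exact Set.Ioc_subset_Icc_self

/-- Continuous functions are integrable on `betaBox`. [folklore] -/
theorem integrableOn_betaBox_of_continuous {φ : (Fin k → ℝ) → ℝ} (hφ : Continuous φ) {R : ℝ}
    (hR : 1 ≤ R) (i₀ : Fin k) : IntegrableOn φ (betaBox k R i₀) :=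
  (hφ.integrableOn_Icc (a := (0 : Fin k → ℝ)) (b := fun _ => R)).mono_set (betaBox_subset_Icc hR i₀)

/-- The `i₀`-marginal mass `m_l = ∫₀^{R} ζ(u/δ - l_{i₀}) du` of the bump `l`. [cite: Polymath8b2014, §5.3, pp. 21–23] -/
def bumpMass (δ R : ℝ) (i₀ : Fin k) (l : Fin k → ℤ) : ℝ :=
  ∫ u in (0 : ℝ)..R, pouBump (u / δ - l i₀)

/-- The reduced tensor bump `T̂_l(x) = ∏_{i ≠ i₀} ζ(xᵢ/δ - lᵢ)` (independent of `x_{i₀}`). [cite: Polymath8b2014, §5.3, pp. 21–23] -/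
def tensorBumpErase (δ : ℝ) (i₀ : Fin k) (l : Fin k → ℤ) (x : Fin k → ℝ) : ℝ :=
  ∏ i ∈ univ.erase i₀, pouBump (x i / δ - l i)

/-- Reduced tensor bumps are nonnegative. [folklore] -/
theorem tensorBumpErase_nonneg (δ : ℝ) (i₀ : Fin k) (l : Fin k → ℤ) (x : Fin k → ℝ) :
    0 ≤ tensorBumpErase δ i₀ l x :=
  Finset.prod_nonneg fun _ _ => pouBump_nonneg _

/-- Reduced tensor bumps are continuous. [folklore] -/
theorem tensorBumpErase_continuous (δ : ℝ) (i₀ : Fin k) (l : Fin k → ℤ) :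
    Continuous (tensorBumpErase δ i₀ l) :=
  continuous_finsetProd _ fun i _ =>
    pouBump_continuous.comp (by fun_prop : Continuous fun a : Fin k → ℝ => a i / δ - (l i : ℝ))

/-- `Ψ_S(x) = ∑_{l ∈ S} c_l m_l T̂_l(x)`: the `i₀`-marginal of the partial tensor sum over `S`. [cite: Polymath8b2014, §5.3, pp. 21–23] -/
def marginalSum (δ R : ℝ) (i₀ : Fin k) (S : Finset (Fin k → ℤ)) (c : (Fin k → ℤ) → ℝ)
    (x : Fin k → ℝ) : ℝ :=
  ∑ l ∈ S, c l * bumpMass δ R i₀ l * tensorBumpErase δ i₀ l x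

/-- The marginals `Ψ_S` are continuous. [folklore] -/
theorem marginalSum_continuous (δ R : ℝ) (i₀ : Fin k) (S : Finset (Fin k → ℤ))
    (c : (Fin k → ℤ) → ℝ) : Continuous (marginalSum δ R i₀ S c) :=
  continuous_finsetSum _ fun l _ => continuous_const.mul (tensorBumpErase_continuous δ i₀ l)

/-- The pair integral behind `β`: `∏_{i ≠ i₀} ∫₀^R ζ_{l,i} ζ_{l',i} = ∫_{betaBox} T̂_l T̂_{l'}`. [cite: Polymath8b2014, §5.3, pp. 21–23] -/
theorem prod_erase_integral_eq_integral_betaBox {δ R : ℝ} (i₀ : Fin k) (l l' : Fin k → ℤ) :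
    ∏ i ∈ univ.erase i₀, ∫ x in Set.Ioc 0 R, pouBump (x / δ - l i) * pouBump (x / δ - l' i) =
      ∫ x in betaBox k R i₀, tensorBumpErase δ i₀ l x * tensorBumpErase δ i₀ l' x := by
  classical
  set φ : Fin k → ℝ → ℝ := fun i u =>
    if i = i₀ then 1 else pouBump (u / δ - l i) * pouBump (u / δ - l' i) with hφ
  have h1 : ∏ i, ∫ x in (if i = i₀ then Set.Ioc 0 1 else Set.Ioc 0 R), φ i x =
      ∏ i ∈ univ.erase i₀, ∫ x in Set.Ioc 0 R,
        pouBump (x / δ - l i) * pouBump (x / δ - l' i) := by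
    rw [← Finset.mul_prod_erase _ _ (Finset.mem_univ i₀)]
    have h0 : ∫ x in (if i₀ = i₀ then Set.Ioc 0 1 else Set.Ioc 0 R), φ i₀ x = 1 := by
      simp [hφ]
    rw [h0, one_mul]
    refine Finset.prod_congr rfl fun i hi => ?_
    have hi' : i ≠ i₀ := Finset.ne_of_mem_erase hi
    simp [hφ, hi']
  rw [← h1, prod_setIntegral_eq_integral_pi]
  refine setIntegral_congr_fun (measurableSet_betaBox R i₀) fun x _ => ?_
  rw [← Finset.mul_prod_erase _ _ (Finset.mem_univ i₀)]
  simp only [hφ, if_pos rfl, one_mul, tensorBumpErase, ← Finset.prod_mul_distrib]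
  refine Finset.prod_congr rfl fun i hi => ?_
  rw [if_neg (Finset.ne_of_mem_erase hi)]

/-- **`β_{i₀} = ρ^{k+1} ∫_{betaBox} (Ψ₁ + 2Ψ₂) Ψ₁`** for the cutoff family `f_{l,i}`, where
`Ψ₁ = Ψ_{𝒥₁}` and `Ψ₂ = Ψ_{J ∖ 𝒥₁}`. [cite: Polymath8b2014, §5.3, pp. 21–23] -/
theorem tensorBeta_pouCutoff {ρ δ : ℝ} (hρ : 0 < ρ) (hρ1 : ρ ≤ 1) (hδ : 0 < δ)
    (J : Finset (Fin k → ℤ)) (c : (Fin k → ℤ) → ℝ) (J₁ : Fin k → Finset (Fin k → ℤ))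
    (i₀ : Fin k) (hJ₁ : J₁ i₀ ⊆ J) (hk : 1 ≤ k)
    (hl : ∀ l ∈ J, δ * (l i₀ + 1) ≤ 1 / ρ) :
    tensorBeta J c (fun i l => pouCutoff ρ δ l i) J₁ i₀ =
      ρ ^ (k + 1) * ∫ x in betaBox k (1 / ρ) i₀,
        (marginalSum δ (1 / ρ) i₀ (J₁ i₀) c x +
            2 * marginalSum δ (1 / ρ) i₀ (J.filter fun l => l ∉ J₁ i₀) c x) *
          marginalSum δ (1 / ρ) i₀ (J₁ i₀) c x := by
  classical
  have hR : (1 : ℝ) ≤ 1 / ρ := by rw [le_div_iff₀ hρ]; linarith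
  have hR0 : (0 : ℝ) ≤ 1 / ρ := by positivity
  -- the integrand of the `(l, l')` term
  set g : (Fin k → ℤ) → (Fin k → ℤ) → (Fin k → ℝ) → ℝ := fun l l' x =>
    ((if l ∈ J₁ i₀ then (1 : ℝ) else 2) * (c l * bumpMass δ (1 / ρ) i₀ l *
      tensorBumpErase δ i₀ l x)) * (c l' * bumpMass δ (1 / ρ) i₀ l' * tensorBumpErase δ i₀ l' x)
    with hg
  -- Step 1: each term of `β`
  have hterm : ∀ l ∈ J, ∀ l' ∈ J₁ i₀,
      (if l ∈ J₁ i₀ then (1 : ℝ) else 2) * (c l * c l') *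
          (pouCutoff ρ δ l i₀ 0 * pouCutoff ρ δ l' i₀ 0) *
        ∏ i ∈ univ.erase i₀, ∫ t in (0 : ℝ)..1,
          deriv (pouCutoff ρ δ l i) t * deriv (pouCutoff ρ δ l' i) t =
      ρ ^ (k + 1) * ∫ x in betaBox k (1 / ρ) i₀, g l l' x := by
    intro l hlJ l' hl'
    have hl'J : l' ∈ J := hJ₁ hl'
    simp_rw [integral_deriv_pouCutoff_mul hρ hδ, intervalIntegral.integral_of_le hR0,
      Finset.prod_mul_distrib, Finset.prod_const, Finset.card_erase_of_mem (Finset.mem_univ _),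
      Finset.card_univ, Fintype.card_fin]
    rw [prod_erase_integral_eq_integral_betaBox, pouCutoff_zero_eq_integral hδ l i₀ (hl l hlJ),
      pouCutoff_zero_eq_integral hδ l' i₀ (hl l' hl'J)]
    have : ∫ x in betaBox k (1 / ρ) i₀, g l l' x =
        ((if l ∈ J₁ i₀ then (1 : ℝ) else 2) * (c l * c l') *
          (bumpMass δ (1 / ρ) i₀ l * bumpMass δ (1 / ρ) i₀ l')) *
        ∫ x in betaBox k (1 / ρ) i₀, tensorBumpErase δ i₀ l x * tensorBumpErase δ i₀ l' x := by
      rw [← integral_const_mul]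
      exact setIntegral_congr_fun (measurableSet_betaBox _ _) fun x _ => by
        simp only [hg]; ring
    rw [this]
    simp only [bumpMass]
    obtain ⟨k', rfl⟩ : ∃ k', k = k' + 1 := ⟨k - 1, by omega⟩
    simp only [Nat.add_sub_cancel, pow_succ]
    ring
  -- Step 2: sum up
  have hint : ∀ l l', IntegrableOn (g l l') (betaBox k (1 / ρ) i₀) :=
    fun l l' => integrableOn_betaBox_of_continuous ((continuous_const.mul
      (continuous_const.mul (tensorBumpErase_continuous δ i₀ l))).mul
        (continuous_const.mul (tensorBumpErase_continuous δ i₀ l'))) hR i₀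
  unfold tensorBeta
  rw [Finset.sum_congr rfl fun l hl => Finset.sum_congr rfl fun l' hl' => hterm l hl l' hl']
  simp_rw [← Finset.mul_sum]
  congr 1
  have h2 : ∀ l ∈ J, ∑ l' ∈ J₁ i₀, ∫ x in betaBox k (1 / ρ) i₀, g l l' x =
      ∫ x in betaBox k (1 / ρ) i₀, ∑ l' ∈ J₁ i₀, g l l' x :=
    fun l _ => (integral_finsetSum _ fun l' _ => hint l l').symm
  rw [Finset.sum_congr rfl h2,
    ← integral_finsetSum _ fun l _ => integrable_finsetSum _ fun l' _ => hint l l']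
  refine setIntegral_congr_fun (measurableSet_betaBox _ _) fun x _ => ?_
  -- pointwise algebra: Σ_{l ∈ J} Σ_{l' ∈ J₁} g l l' x = (Ψ₁ + 2Ψ₂) Ψ₁
  have hsplit : ∑ l ∈ J, (if l ∈ J₁ i₀ then (1 : ℝ) else 2) *
      (c l * bumpMass δ (1 / ρ) i₀ l * tensorBumpErase δ i₀ l x) =
      marginalSum δ (1 / ρ) i₀ (J₁ i₀) c x +
        2 * marginalSum δ (1 / ρ) i₀ (J.filter fun l => l ∉ J₁ i₀) c x := by
    rw [← Finset.sum_filter_add_sum_filter_not J (· ∈ J₁ i₀), Finset.filter_mem_eq_inter,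
      Finset.inter_eq_right.2 hJ₁]
    simp only [marginalSum, Finset.mul_sum]
    congr 1
    · refine Finset.sum_congr rfl fun l hl => ?_
      simp [hl]
    · refine Finset.sum_congr rfl fun l hl => ?_
      have hl' : l ∉ J₁ i₀ := (Finset.mem_filter.1 hl).2
      simp [hl']
  simp only [hg]
  rw [← hsplit, Finset.sum_mul]
  refine Finset.sum_congr rfl fun l _ => ?_
  rw [marginalSum, Finset.mul_sum]

end BetaBox


/-! ### The `i₀`-marginal of the tensor sum: `M⁺G = Ψ_J` -/

section Marginal

variable {k : ℕ}

/-- A continuous function vanishing on `[T, ∞)`, `T ≥ 0`: `∫_{u > 0} g = ∫₀^T g`. [folklore] -/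
theorem setIntegral_Ioi_eq_intervalIntegral {g : ℝ → ℝ} (hg : Continuous g) {T : ℝ} (hT : 0 ≤ T)
    (h0 : ∀ u, T ≤ u → g u = 0) : ∫ u in Set.Ioi 0, g u = ∫ u in (0 : ℝ)..T, g u := by
  have hz : ∫ u in Set.Ioi T, g u = 0 :=
    (setIntegral_congr_fun measurableSet_Ioi (g := fun _ => (0 : ℝ)) fun u hu =>
      h0 u (le_of_lt hu)).trans (by simp)
  rw [intervalIntegral.integral_of_le hT, ← Set.Ioc_union_Ioi_eq_Ioi hT,
    setIntegral_union (Set.Ioc_disjoint_Ioi le_rfl) measurableSet_Ioi hg.integrableOn_Ioc ?_,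
    hz, add_zero]
  exact integrableOn_zero.congr_fun (fun u hu => (h0 u (le_of_lt hu)).symm) measurableSet_Ioi

/-- A continuous function vanishing on `[T, ∞)` is integrable on `(0, ∞)`. [folklore] -/
theorem integrableOn_Ioi_of_eq_zero {g : ℝ → ℝ} (hg : Continuous g) {T : ℝ} (hT : 0 ≤ T)
    (h0 : ∀ u, T ≤ u → g u = 0) : IntegrableOn g (Set.Ioi 0) := by
  rw [← Set.Ioc_union_Ioi_eq_Ioi hT]
  exact hg.integrableOn_Ioc.union
    (integrableOn_zero.congr_fun (fun u hu => (h0 u (le_of_lt hu)).symm) measurableSet_Ioi)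

/-- Evaluating a tensor bump at `update x i₀ u` splits off the `i₀`-th factor. [folklore] -/
theorem tensorBump_update (δ : ℝ) (l : Fin k → ℤ) (x : Fin k → ℝ) (i₀ : Fin k) (u : ℝ) :
    tensorBump δ l (Function.update x i₀ u) = pouBump (u / δ - l i₀) * tensorBumpErase δ i₀ l x := by
  unfold tensorBump tensorBumpErase
  rw [← Finset.mul_prod_erase _ _ (Finset.mem_univ i₀), Function.update_self]
  congr 1
  refine Finset.prod_congr rfl fun i hi => ?_
  rw [Function.update_of_ne (Finset.ne_of_mem_erase hi)]

/-- **`M⁺G = Ψ_J`**: `∫_{u > 0} G(update x i₀ u) du = ∑_{l ∈ J} c_l m_l T̂_l(x)` provided every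
bump in `J` ends before `R` in the `i₀`-direction. [cite: Polymath8b2014, §5.3, pp. 21–23] -/
theorem setIntegral_Ioi_tensorSum_update {δ R : ℝ} (hδ : 0 < δ) (hR : 0 ≤ R)
    (J : Finset (Fin k → ℤ)) (c : (Fin k → ℤ) → ℝ) (i₀ : Fin k)
    (hl : ∀ l ∈ J, δ * (l i₀ + 1) ≤ R) (x : Fin k → ℝ) :
    ∫ u in Set.Ioi 0, tensorSum δ J c (Function.update x i₀ u) = marginalSum δ R i₀ J c x := by
  have hcont : ∀ l : Fin k → ℤ, Continuous fun u : ℝ => pouBump (u / δ - l i₀) := fun l =>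
    pouBump_continuous.comp ((continuous_id.div_const δ).sub continuous_const)
  have hrepr : ∀ u, tensorSum δ J c (Function.update x i₀ u) =
      ∑ l ∈ J, c l * tensorBumpErase δ i₀ l x * pouBump (u / δ - l i₀) := fun u => by
    unfold tensorSum
    refine Finset.sum_congr rfl fun l _ => ?_
    rw [tensorBump_update]; ring
  simp_rw [hrepr]
  have hint : ∀ l ∈ J, IntegrableOn (fun u => c l * tensorBumpErase δ i₀ l x * pouBump (u / δ - l i₀))
      (Set.Ioi 0) := fun l hlJ =>
    (integrableOn_Ioi_of_eq_zero (hcont l) hR fun u hu =>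
      pouBump_div_sub_eq_zero_of_le hδ ((hl l hlJ).trans hu)).const_mul _
  rw [integral_finsetSum _ hint, marginalSum]
  refine Finset.sum_congr rfl fun l hlJ => ?_
  rw [integral_const_mul, bumpMass, setIntegral_Ioi_eq_intervalIntegral (hcont l) hR fun u hu =>
    pouBump_div_sub_eq_zero_of_le hδ ((hl l hlJ).trans hu)]
  ring

end Marginal

/-! ### Geometry of the supports: where `Ψ_{𝒥₁}` and `Ψ_{J ∖ 𝒥₁}` live -/

section Geometry

variable {k : ℕ}

/-- If `T̂_l(x) ≠ 0` then `δ(lᵢ - 1) < xᵢ < δ(lᵢ + 1)` for every `i ≠ i₀`. [folklore] -/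
theorem lt_of_tensorBumpErase_ne_zero {δ : ℝ} (hδ : 0 < δ) {i₀ : Fin k} {l : Fin k → ℤ}
    {x : Fin k → ℝ} (h : tensorBumpErase δ i₀ l x ≠ 0) {i : Fin k} (hi : i ≠ i₀) :
    δ * (l i - 1) < x i ∧ x i < δ * (l i + 1) := by
  have hfac : pouBump (x i / δ - l i) ≠ 0 := fun h0 =>
    h (Finset.prod_eq_zero (Finset.mem_erase.2 ⟨hi, Finset.mem_univ i⟩) h0)
  constructor
  · by_contra hle
    exact hfac (pouBump_div_sub_eq_zero_of_ge hδ (not_lt.1 hle))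
  · by_contra hle
    exact hfac (pouBump_div_sub_eq_zero_of_le hδ (not_lt.1 hle))

/-- `univ.erase i₀` is nonempty when `k ≥ 2`. [folklore] -/
theorem erase_univ_nonempty {i₀ : Fin k} (hk : 2 ≤ k) : (univ.erase i₀ : Finset (Fin k)).Nonempty := by
  rw [← Finset.card_pos, Finset.card_erase_of_mem (Finset.mem_univ _), Finset.card_univ,
    Fintype.card_fin]
  omega

/-- Bumps with `∑_{i ≠ i₀} δ(lᵢ + 1) ≥ Λ` vanish where `∑_{i ≠ i₀} xᵢ ≤ Λ - 2(k-1)δ` (`k ≥ 2`). [cite: Polymath8b2014, §5.3, pp. 21–23] -/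
theorem tensorBumpErase_eq_zero_of_sum_le {δ : ℝ} (hδ : 0 < δ) {i₀ : Fin k} {l : Fin k → ℤ}
    {Λ : ℝ} (hl : Λ ≤ ∑ i ∈ univ.erase i₀, δ * (l i + 1)) {x : Fin k → ℝ}
    (hx : ∑ i ∈ univ.erase i₀, x i ≤ Λ - 2 * (k - 1) * δ) (hk : 2 ≤ k) :
    tensorBumpErase δ i₀ l x = 0 := by
  by_contra h
  have h1 : ∑ i ∈ univ.erase i₀, (δ * (l i + 1) - 2 * δ) < ∑ i ∈ univ.erase i₀, x i :=
    Finset.sum_lt_sum_of_nonempty (erase_univ_nonempty hk) fun i hi => by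
      have := (lt_of_tensorBumpErase_ne_zero hδ h (Finset.ne_of_mem_erase hi)).1
      linarith
  have h2 : ∑ i ∈ univ.erase i₀, (δ * (l i + 1) - 2 * δ) =
      ∑ i ∈ univ.erase i₀, δ * (l i + 1) - 2 * (k - 1) * δ := by
    rw [Finset.sum_sub_distrib, Finset.sum_const, Finset.card_erase_of_mem (Finset.mem_univ _),
      Finset.card_univ, Fintype.card_fin, nsmul_eq_mul]
    push_cast [Nat.cast_sub (by omega : 1 ≤ k)]
    ring
  rw [h2] at h1
  linarith

/-- Bumps with `∑_{i ≠ i₀} δ(lᵢ + 1) ≤ Λ` vanish where `∑_{i ≠ i₀} xᵢ ≥ Λ` (`k ≥ 2`). [cite: Polymath8b2014, §5.3, pp. 21–23] -/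
theorem tensorBumpErase_eq_zero_of_le_sum {δ : ℝ} (hδ : 0 < δ) {i₀ : Fin k} {l : Fin k → ℤ}
    {Λ : ℝ} (hl : ∑ i ∈ univ.erase i₀, δ * (l i + 1) ≤ Λ) {x : Fin k → ℝ}
    (hx : Λ ≤ ∑ i ∈ univ.erase i₀, x i) (hk : 2 ≤ k) :
    tensorBumpErase δ i₀ l x = 0 := by
  by_contra h
  have h1 : ∑ i ∈ univ.erase i₀, x i < ∑ i ∈ univ.erase i₀, δ * (l i + 1) :=
    Finset.sum_lt_sum_of_nonempty (erase_univ_nonempty hk) fun i hi =>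
      (lt_of_tensorBumpErase_ne_zero hδ h (Finset.ne_of_mem_erase hi)).2
  linarith

/-- Hence `Ψ_S(x) = 0` below the shell when every `l ∈ S` has `∑_{i ≠ i₀} δ(lᵢ + 1) ≥ Λ`. [cite: Polymath8b2014, §5.3, pp. 21–23] -/
theorem marginalSum_eq_zero_of_sum_le {δ R : ℝ} (hδ : 0 < δ) {i₀ : Fin k}
    {S : Finset (Fin k → ℤ)} {c : (Fin k → ℤ) → ℝ} {Λ : ℝ}
    (hS : ∀ l ∈ S, Λ ≤ ∑ i ∈ univ.erase i₀, δ * (l i + 1)) {x : Fin k → ℝ}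
    (hx : ∑ i ∈ univ.erase i₀, x i ≤ Λ - 2 * (k - 1) * δ) (hk : 2 ≤ k) :
    marginalSum δ R i₀ S c x = 0 :=
  Finset.sum_eq_zero fun l hl => by
    rw [tensorBumpErase_eq_zero_of_sum_le hδ (hS l hl) hx hk, mul_zero]

/-- And `Ψ_S(x) = 0` above `Λ` when every `l ∈ S` has `∑_{i ≠ i₀} δ(lᵢ + 1) ≤ Λ`. [cite: Polymath8b2014, §5.3, pp. 21–23] -/
theorem marginalSum_eq_zero_of_le_sum {δ R : ℝ} (hδ : 0 < δ) {i₀ : Fin k}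
    {S : Finset (Fin k → ℤ)} {c : (Fin k → ℤ) → ℝ} {Λ : ℝ}
    (hS : ∀ l ∈ S, ∑ i ∈ univ.erase i₀, δ * (l i + 1) ≤ Λ) {x : Fin k → ℝ}
    (hx : Λ ≤ ∑ i ∈ univ.erase i₀, x i) (hk : 2 ≤ k) :
    marginalSum δ R i₀ S c x = 0 :=
  Finset.sum_eq_zero fun l hl => by
    rw [tensorBumpErase_eq_zero_of_le_sum hδ (hS l hl) hx hk, mul_zero]

/-- The pointwise lower bound for the `β`-integrand (Polymath 8b p. 22: the supports of `f_{4,1}`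
and `f_{4,2}` only overlap on the shell): with `Ψ₁ = Ψ_{𝒥₁}` (bumps with `∑ δ(lᵢ+1) < Λ`) and
`Ψ₂ = Ψ_{𝒥₂}` (the others), `|Ψ₁| ≤ B₁`, `|Ψ₂| ≤ B₂`, one has
`(Ψ₁ + 2Ψ₂) Ψ₁ ≥ 𝟙[∑ xᵢ ≤ Λ - 2(k-1)δ] (Ψ₁ + Ψ₂)² - 2 B₁ B₂ 𝟙[shell]`. [cite: Polymath8b2014, §5.3, pp. 21–23] -/
theorem beta_integrand_lower_bound {δ R : ℝ} (hδ : 0 < δ) {i₀ : Fin k}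
    {S₁ S₂ : Finset (Fin k → ℤ)} {c : (Fin k → ℤ) → ℝ} {Λ : ℝ}
    (hS₁ : ∀ l ∈ S₁, ∑ i ∈ univ.erase i₀, δ * (l i + 1) ≤ Λ)
    (hS₂ : ∀ l ∈ S₂, Λ ≤ ∑ i ∈ univ.erase i₀, δ * (l i + 1)) (hk : 2 ≤ k)
    {B₁ B₂ : ℝ} {x : Fin k → ℝ} (hB₁ : |marginalSum δ R i₀ S₁ c x| ≤ B₁)
    (hB₂ : |marginalSum δ R i₀ S₂ c x| ≤ B₂) :
    (if ∑ i ∈ univ.erase i₀, x i ≤ Λ - 2 * (k - 1) * δ then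
        (marginalSum δ R i₀ S₁ c x + marginalSum δ R i₀ S₂ c x) ^ 2 else 0) -
      (if Λ - 2 * (k - 1) * δ < ∑ i ∈ univ.erase i₀, x i ∧ ∑ i ∈ univ.erase i₀, x i < Λ then
        2 * B₁ * B₂ else 0) ≤
    (marginalSum δ R i₀ S₁ c x + 2 * marginalSum δ R i₀ S₂ c x) * marginalSum δ R i₀ S₁ c x := by
  set P₁ := marginalSum δ R i₀ S₁ c x
  set P₂ := marginalSum δ R i₀ S₂ c x
  by_cases h1 : ∑ i ∈ univ.erase i₀, x i ≤ Λ - 2 * (k - 1) * δ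
  · have hP₂ : P₂ = 0 := marginalSum_eq_zero_of_sum_le hδ hS₂ h1 hk
    rw [if_pos h1, if_neg (fun h => (not_lt.2 h1) h.1), hP₂]
    nlinarith
  · rw [if_neg h1]
    push Not at h1
    by_cases h2 : ∑ i ∈ univ.erase i₀, x i < Λ
    · rw [if_pos ⟨h1, h2⟩]
      have hB₁0 : 0 ≤ B₁ := (abs_nonneg _).trans hB₁
      have hB₂0 : 0 ≤ B₂ := (abs_nonneg _).trans hB₂
      have h3 : |P₁ * P₂| ≤ B₁ * B₂ := by
        rw [abs_mul]; exact mul_le_mul hB₁ hB₂ (abs_nonneg _) hB₁0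
      have h4 := neg_abs_le (P₁ * P₂)
      nlinarith [sq_nonneg P₁]
    · push Not at h2
      have hP₁ : P₁ = 0 := marginalSum_eq_zero_of_le_sum hδ hS₁ h2 hk
      rw [if_neg (fun h => (not_lt.2 h2) h.2), hP₁]
      simp

end Geometry


/-! ### Uniform bounds for the marginals `Ψ_S` -/

section SupBounds

variable {k : ℕ}

/-- `∑_{l ∈ J} T_l(y) ≤ 1` for `J ⊆ box` and `y/δ ∈ [-L, L]^k`. [folklore] -/
theorem sum_tensorBump_le_one {δ : ℝ} {L : ℕ} {J : Finset (Fin k → ℤ)} (hJ : J ⊆ indexBox k L)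
    {y : Fin k → ℝ} (hy : ∀ i, -(L : ℝ) ≤ y i / δ ∧ y i / δ ≤ L) :
    ∑ l ∈ J, tensorBump δ l y ≤ 1 := by
  rw [← sum_tensorBump_eq_one hy]
  exact Finset.sum_le_sum_of_subset_of_nonneg hJ fun l _ _ => tensorBump_nonneg δ l y

/-- `∑_{l ∈ J} m_l T̂_l(x) ≤ 2`: the total `i₀`-marginal mass seen at `x` is at most the length of
the `u`-range `(0, 2]` carrying bumps. [cite: Polymath8b2014, §5.3, pp. 21–23] -/
theorem sum_bumpMass_mul_tensorBumpErase_le_two {δ ρ : ℝ} (hδ : 0 < δ) (hρ : 0 < ρ)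
    (h2R : 2 ≤ 1 / ρ) {L : ℕ} (hL : 1 / (ρ * δ) ≤ L) {J : Finset (Fin k → ℤ)}
    (hJ : J ⊆ indexBox k L) (i₀ : Fin k) (hl2 : ∀ l ∈ J, δ * (l i₀ + 1) ≤ 2)
    {x : Fin k → ℝ} (hx : ∀ i, i ≠ i₀ → 0 < x i ∧ x i ≤ 1 / ρ) :
    ∑ l ∈ J, bumpMass δ (1 / ρ) i₀ l * tensorBumpErase δ i₀ l x ≤ 2 := by
  have hR0 : (0 : ℝ) ≤ 1 / ρ := by positivity
  have hcont : ∀ l : Fin k → ℤ, Continuous fun u : ℝ => pouBump (u / δ - l i₀) := fun l =>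
    pouBump_continuous.comp ((continuous_id.div_const δ).sub continuous_const)
  -- rewrite as one integral of `u ↦ Σ_l T_l(update x i₀ u)`
  have hcl : ∀ l : Fin k → ℤ, Continuous fun u : ℝ => tensorBump δ l (Function.update x i₀ u) :=
    fun l => (tensorBump_continuous δ l).comp (by fun_prop)
  have h1 : ∑ l ∈ J, bumpMass δ (1 / ρ) i₀ l * tensorBumpErase δ i₀ l x =
      ∫ u in (0 : ℝ)..1 / ρ, ∑ l ∈ J, tensorBump δ l (Function.update x i₀ u) := by
    rw [intervalIntegral.integral_finsetSum fun l _ => (hcl l).intervalIntegrable _ _]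
    refine Finset.sum_congr rfl fun l _ => ?_
    simp_rw [tensorBump_update, bumpMass]
    rw [intervalIntegral.integral_mul_const]
  rw [h1]
  -- coordinates of `update x i₀ u` lie in the PoU range for `0 < u ≤ 1/ρ`
  have hbox : ∀ u, 0 < u → u ≤ 1 / ρ →
      ∀ i, -(L : ℝ) ≤ Function.update x i₀ u i / δ ∧ Function.update x i₀ u i / δ ≤ L := by
    intro u hu0 hu1 i
    have key : ∀ v : ℝ, 0 < v → v ≤ 1 / ρ → -(L : ℝ) ≤ v / δ ∧ v / δ ≤ L := fun v hv0 hv1 => by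
      constructor
      · have : 0 ≤ v / δ := div_nonneg hv0.le hδ.le
        linarith [(Nat.cast_nonneg L : (0 : ℝ) ≤ L)]
      · calc v / δ ≤ (1 / ρ) / δ := div_le_div_of_nonneg_right hv1 hδ.le
          _ = 1 / (ρ * δ) := by rw [div_div]
          _ ≤ L := hL
    by_cases hi : i = i₀
    · subst hi; rw [Function.update_self]; exact key u hu0 hu1
    · rw [Function.update_of_ne hi]; exact key (x i) (hx i hi).1 (hx i hi).2
  -- split at `u = 2`
  have hcs : Continuous fun u : ℝ => ∑ l ∈ J, tensorBump δ l (Function.update x i₀ u) :=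
    continuous_finsetSum _ fun l _ => hcl l
  have hint : ∀ a b : ℝ, IntervalIntegrable
      (fun u => ∑ l ∈ J, tensorBump δ l (Function.update x i₀ u)) volume a b := fun a b =>
    hcs.intervalIntegrable _ _
  rw [← intervalIntegral.integral_add_adjacent_intervals (b := 2) (hint _ _) (hint _ _)]
  have hzero : ∫ u in (2 : ℝ)..1 / ρ, ∑ l ∈ J, tensorBump δ l (Function.update x i₀ u) = 0 := by
    refine intervalIntegral.integral_zero_ae (ae_of_all _ fun u hu => ?_)
    rw [Set.uIoc_of_le h2R] at hu
    refine Finset.sum_eq_zero fun l hl => ?_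
    rw [tensorBump_update, pouBump_div_sub_eq_zero_of_le hδ ((hl2 l hl).trans hu.1.le), zero_mul]
  have hle : ∫ u in (0 : ℝ)..2, ∑ l ∈ J, tensorBump δ l (Function.update x i₀ u) ≤
      ∫ u in (0 : ℝ)..2, (1 : ℝ) := by
    refine intervalIntegral.integral_mono_on_of_le_Ioo (by norm_num) (hint _ _) (by simp) ?_
    intro u hu
    exact sum_tensorBump_le_one hJ (hbox u hu.1 (hu.2.le.trans h2R))
  rw [hzero, add_zero]
  refine hle.trans ?_
  simp

/-- **Sup bound**: `|Ψ_S(x)| ≤ 2B` on the box, for `S ⊆ J` and `|c_l| ≤ B`. [cite: Polymath8b2014, §5.3, pp. 21–23] -/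
theorem abs_marginalSum_le {δ ρ : ℝ} (hδ : 0 < δ) (hρ : 0 < ρ) (h2R : 2 ≤ 1 / ρ) {L : ℕ}
    (hL : 1 / (ρ * δ) ≤ L) {J S : Finset (Fin k → ℤ)} (hS : S ⊆ J) (hJ : J ⊆ indexBox k L)
    (i₀ : Fin k) (hl2 : ∀ l ∈ J, δ * (l i₀ + 1) ≤ 2) {c : (Fin k → ℤ) → ℝ} {B : ℝ} (hB0 : 0 ≤ B)
    (hB : ∀ l ∈ J, |c l| ≤ B) {x : Fin k → ℝ} (hx : ∀ i, i ≠ i₀ → 0 < x i ∧ x i ≤ 1 / ρ) :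
    |marginalSum δ (1 / ρ) i₀ S c x| ≤ 2 * B := by
  have hm0 : ∀ l, 0 ≤ bumpMass δ (1 / ρ) i₀ l := fun l =>
    intervalIntegral.integral_nonneg (by positivity) fun u _ => pouBump_nonneg _
  unfold marginalSum
  refine (Finset.abs_sum_le_sum_abs _ _).trans ?_
  calc ∑ l ∈ S, |c l * bumpMass δ (1 / ρ) i₀ l * tensorBumpErase δ i₀ l x|
      ≤ ∑ l ∈ S, B * (bumpMass δ (1 / ρ) i₀ l * tensorBumpErase δ i₀ l x) :=
        Finset.sum_le_sum fun l hl => by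
          rw [abs_mul, abs_mul, abs_of_nonneg (hm0 l), abs_of_nonneg (tensorBumpErase_nonneg _ _ _ _),
            mul_assoc]
          exact mul_le_mul_of_nonneg_right (hB l (hS hl))
            (mul_nonneg (hm0 l) (tensorBumpErase_nonneg _ _ _ _))
    _ ≤ ∑ l ∈ J, B * (bumpMass δ (1 / ρ) i₀ l * tensorBumpErase δ i₀ l x) :=
        Finset.sum_le_sum_of_subset_of_nonneg hS fun l _ _ =>
          mul_nonneg hB0 (mul_nonneg (hm0 l) (tensorBumpErase_nonneg _ _ _ _))
    _ = B * ∑ l ∈ J, bumpMass δ (1 / ρ) i₀ l * tensorBumpErase δ i₀ l x := by rw [Finset.mul_sum]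
    _ ≤ B * 2 := mul_le_mul_of_nonneg_left
        (sum_bumpMass_mul_tensorBumpErase_le_two hδ hρ h2R hL hJ i₀ hl2 hx) hB0
    _ = 2 * B := mul_comm _ _

end SupBounds


/-! ### Fubini along one coordinate: volumes through fibres -/

section Fibre

variable {n : ℕ}

/-- The coordinate-splitting measurable equivalence `x ↦ (x_j, (x_i)_{i ≠ j})`. [folklore] -/
abbrev splitEquiv (n : ℕ) (j : Fin (n + 1)) : (Fin (n + 1) → ℝ) ≃ᵐ ℝ × (Fin n → ℝ) :=
  MeasurableEquiv.piFinSuccAbove (fun _ => ℝ) j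

/-- The coordinate splitting preserves Lebesgue measure. [folklore] -/
theorem splitEquiv_measurePreserving (j : Fin (n + 1)) :
    MeasurePreserving (splitEquiv n j) volume volume :=
  volume_preserving_piFinSuccAbove (fun _ => ℝ) j

/-- The inverse splitting is `Fin.insertNth`. [folklore] -/
theorem splitEquiv_symm_apply (j : Fin (n + 1)) (p : ℝ × (Fin n → ℝ)) :
    (splitEquiv n j).symm p = Fin.insertNth j p.1 p.2 := rfl

/-- **Volume through fibres**: if every `j`-fibre of a measurable set `S` over `y` lies in an
interval of length `w`, and is empty unless `y ∈ Y`, then `vol S ≤ w · vol Y`. [folklore] -/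
theorem volume_le_of_fibre (j : Fin (n + 1)) {S : Set (Fin (n + 1) → ℝ)} (hS : MeasurableSet S)
    {w : ℝ} {Y : Set (Fin n → ℝ)} (hY : MeasurableSet Y)
    (hfib : ∀ y ∈ Y, ∃ a : ℝ, ∀ u, Fin.insertNth j u y ∈ S → u ∈ Set.Icc a (a + w))
    (hout : ∀ y u, Fin.insertNth j u y ∈ S → y ∈ Y) :
    volume S ≤ ENNReal.ofReal w * volume Y := by
  have hE := (splitEquiv_measurePreserving j).symm
  rw [← hE.measure_preimage_equiv S, Measure.volume_eq_prod,
    Measure.prod_apply_symm ((splitEquiv n j).symm.measurable hS), ← lintegral_indicator_const hY]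
  refine lintegral_mono fun y => ?_
  have hset : (fun u : ℝ => (u, y)) ⁻¹' ((splitEquiv n j).symm ⁻¹' S) =
      {u | Fin.insertNth j u y ∈ S} := Set.ext fun u => Iff.rfl
  rw [hset]
  by_cases hy : y ∈ Y
  · rw [Set.indicator_of_mem hy]
    obtain ⟨a, ha⟩ := hfib y hy
    calc volume {u | Fin.insertNth j u y ∈ S} ≤ volume (Set.Icc a (a + w)) :=
          measure_mono fun u hu => ha u hu
      _ = ENNReal.ofReal w := by rw [Real.volume_Icc]; ring_nf
  · rw [Set.indicator_of_notMem hy]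
    have : {u | Fin.insertNth j u y ∈ S} = ∅ :=
      Set.eq_empty_iff_forall_notMem.2 fun u hu => hy (hout y u hu)
    rw [this, measure_empty]

/-- Inserting the `j`-th coordinate does not change the other coordinates. [folklore] -/
theorem insertNth_apply_of_ne (j : Fin (n + 1)) (u v : ℝ) (y : Fin n → ℝ) {i : Fin (n + 1)}
    (hi : i ≠ j) :
    Fin.insertNth (α := fun _ => ℝ) j u y i = Fin.insertNth (α := fun _ => ℝ) j v y i := by
  obtain ⟨m, rfl⟩ := Fin.exists_succAbove_eq hi
  simp

/-- The sum over `i ≠ i₀` of the coordinates of `insertNth j u y` is `u` plus a quantity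
independent of `u`, when `j ≠ i₀`. [folklore] -/
theorem sum_erase_insertNth (i₀ j : Fin (n + 1)) (hj : j ≠ i₀) (u : ℝ) (y : Fin n → ℝ) :
    ∑ i ∈ univ.erase i₀, Fin.insertNth (α := fun _ => ℝ) j u y i =
      u + ∑ i ∈ (univ.erase i₀).erase j, Fin.insertNth (α := fun _ => ℝ) j 0 y i := by
  rw [← Finset.add_sum_erase _ _ (Finset.mem_erase.2 ⟨hj, Finset.mem_univ j⟩)]
  congr 1
  · simp
  · exact Finset.sum_congr rfl fun i hi => insertNth_apply_of_ne j u 0 y (Finset.ne_of_mem_erase hi)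

/-- **The shell has volume `O(δ)`**: for `j ≠ i₀`,
`vol {x ∈ betaBox : Λ - w < ∑_{i ≠ i₀} xᵢ < Λ} ≤ w R^n`. [cite: Polymath8b2014, §5.3, pp. 21–23] -/
theorem volume_shell_le {R : ℝ} (hR : 1 ≤ R) (i₀ j : Fin (n + 1)) (hj : j ≠ i₀) (Λ w : ℝ) :
    volume ({x | Λ - w < ∑ i ∈ univ.erase i₀, x i ∧ ∑ i ∈ univ.erase i₀, x i < Λ} ∩
      betaBox (n + 1) R i₀) ≤ ENNReal.ofReal w * ENNReal.ofReal R ^ n := by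
  have hmeas : MeasurableSet ({x : Fin (n + 1) → ℝ | Λ - w < ∑ i ∈ univ.erase i₀, x i ∧
      ∑ i ∈ univ.erase i₀, x i < Λ} ∩ betaBox (n + 1) R i₀) := by
    refine MeasurableSet.inter ?_ (measurableSet_betaBox R i₀)
    have hc : Measurable fun x : Fin (n + 1) → ℝ => ∑ i ∈ univ.erase i₀, x i :=
      Finset.measurable_sum _ fun i _ => measurable_pi_apply i
    exact (measurableSet_lt measurable_const hc).inter (measurableSet_lt hc measurable_const)
  set Y : Set (Fin n → ℝ) := Set.pi Set.univ fun _ => Set.Ioc 0 R with hYdef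
  have hY : MeasurableSet Y := MeasurableSet.univ_pi fun _ => measurableSet_Ioc
  have hvolY : volume Y = ENNReal.ofReal R ^ n := by
    rw [hYdef, volume_pi_pi]
    simp [Real.volume_Ioc]
  rw [← hvolY]
  refine volume_le_of_fibre j hmeas hY (fun y _ => ?_) (fun y u hu => ?_)
  · refine ⟨Λ - w - ∑ i ∈ (univ.erase i₀).erase j, Fin.insertNth (α := fun _ => ℝ) j 0 y i,
      fun u hu => ?_⟩
    have h : Λ - w < ∑ i ∈ univ.erase i₀, Fin.insertNth (α := fun _ => ℝ) j u y i ∧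
        ∑ i ∈ univ.erase i₀, Fin.insertNth (α := fun _ => ℝ) j u y i < Λ := hu.1
    rw [sum_erase_insertNth i₀ j hj u y] at h
    constructor <;> linarith [h.1, h.2]
  · -- membership in `betaBox` forces `y ∈ Y`
    have hb := hu.2
    simp only [betaBox, Set.mem_univ_pi] at hb
    rw [hYdef, Set.mem_univ_pi]
    intro m
    have := hb (j.succAbove m)
    rw [Fin.insertNth_apply_succAbove] at this
    by_cases h : j.succAbove m = i₀
    · rw [if_pos h] at this
      exact ⟨this.1, this.2.trans hR⟩
    · rw [if_neg h] at this
      exact this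

end Fibre


/-! ### Fubini along `i₀`: integrals of sections -/

section Sections

variable {n : ℕ}

/-- The box `(0, T] × (0, R]^{n}` with the `i₀`-th side `(0, T]`; `betaBox = sideBox R 1`. [folklore] -/
def sideBox (k : ℕ) (R T : ℝ) (i₀ : Fin k) : Set (Fin k → ℝ) :=
  Set.pi Set.univ fun i => if i = i₀ then Set.Ioc 0 T else Set.Ioc 0 R

/-- `betaBox R = sideBox R 1`. [folklore] -/
theorem betaBox_eq_sideBox {k : ℕ} (R : ℝ) (i₀ : Fin k) : betaBox k R i₀ = sideBox k R 1 i₀ := rfl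

/-- `sideBox` is the preimage of a product set under the coordinate splitting. [folklore] -/
theorem sideBox_eq_preimage (R T : ℝ) (i₀ : Fin (n + 1)) :
    sideBox (n + 1) R T i₀ =
      splitEquiv n i₀ ⁻¹' (Set.Ioc 0 T ×ˢ Set.pi Set.univ fun _ => Set.Ioc 0 R) := by
  ext x
  simp only [sideBox, Set.mem_univ_pi, Set.mem_preimage, Set.mem_prod]
  rw [Fin.forall_iff_succAbove i₀]
  simp only [Fin.succAbove_ne, if_false]
  exact Iff.rfl

/-- `sideBox` is measurable. [folklore] -/
theorem measurableSet_sideBox (R T : ℝ) (i₀ : Fin (n + 1)) : MeasurableSet (sideBox (n + 1) R T i₀) :=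
  MeasurableSet.univ_pi fun i => by
    by_cases hi : i = i₀
    · simp only [hi, ↓reduceIte]; exact measurableSet_Ioc
    · simp only [hi, ↓reduceIte]; exact measurableSet_Ioc

/-- **Sections along `i₀`**: `∫_{sideBox} φ = ∫_{y ∈ (0,R]^n} ∫_{u ∈ (0,T]} φ(insertNth i₀ u y)`. [folklore] -/
theorem lintegral_sideBox_eq (R T : ℝ) (i₀ : Fin (n + 1)) {φ : (Fin (n + 1) → ℝ) → ENNReal}
    (hφ : Measurable φ) :
    ∫⁻ x in sideBox (n + 1) R T i₀, φ x =
      ∫⁻ y in Set.pi Set.univ (fun _ => Set.Ioc (0 : ℝ) R), ∫⁻ u in Set.Ioc 0 T,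
        φ (Fin.insertNth (α := fun _ => ℝ) i₀ u y) := by
  have hE := splitEquiv_measurePreserving (n := n) i₀
  have hs : MeasurableSet (Set.Ioc (0 : ℝ) T ×ˢ Set.pi Set.univ fun _ : Fin n => Set.Ioc (0 : ℝ) R) :=
    measurableSet_Ioc.prod (MeasurableSet.univ_pi fun _ => measurableSet_Ioc)
  have h1 := hE.setLIntegral_comp_preimage hs
    (f := fun p => φ ((splitEquiv n i₀).symm p)) (hφ.comp (splitEquiv n i₀).symm.measurable)
  simp only [MeasurableEquiv.symm_apply_apply] at h1
  rw [sideBox_eq_preimage, h1, Measure.volume_eq_prod, ← Measure.prod_restrict,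
    lintegral_prod_symm (fun p => φ ((splitEquiv n i₀).symm p))
      (hφ.comp (splitEquiv n i₀).symm.measurable).aemeasurable]
  rfl

/-- Updating the `i₀`-th coordinate of `insertNth i₀ v y` gives `insertNth i₀ u y`. [folklore] -/
theorem update_insertNth (i₀ : Fin (n + 1)) (u v : ℝ) (y : Fin n → ℝ) :
    Function.update (Fin.insertNth (α := fun _ => ℝ) i₀ v y) i₀ u =
      Fin.insertNth (α := fun _ => ℝ) i₀ u y := by
  rw [← Fin.insertNth_removeNth, Fin.removeNth_insertNth]

/-- **Integrating a `u`-section integral over `betaBox`**: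
`∫_{betaBox} (∫_{(0,T]} ψ(update x i₀ u) du) dx = ∫_{sideBox R T} ψ` (the `x_{i₀}`-fibre of
`betaBox` has length `1` and the integrand does not depend on `x_{i₀}`). [folklore] -/
theorem lintegral_betaBox_section (R T : ℝ) (i₀ : Fin (n + 1)) {ψ : (Fin (n + 1) → ℝ) → ENNReal}
    (hψ : Measurable ψ) :
    ∫⁻ x in betaBox (n + 1) R i₀, ∫⁻ u in Set.Ioc 0 T, ψ (Function.update x i₀ u) =
      ∫⁻ x in sideBox (n + 1) R T i₀, ψ x := by
  classical
  have hmeas : Measurable fun x : Fin (n + 1) → ℝ => ∫⁻ u in Set.Ioc 0 T, ψ (Function.update x i₀ u) := by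
    refine Measurable.lintegral_prod_right (f := fun x u => ψ (Function.update x i₀ u)) ?_
    exact hψ.comp measurable_update'
  rw [betaBox_eq_sideBox, lintegral_sideBox_eq R 1 i₀ hmeas, lintegral_sideBox_eq R T i₀ hψ]
  refine setLIntegral_congr_fun (MeasurableSet.univ_pi fun _ => measurableSet_Ioc) fun y _ => ?_
  simp only [update_insertNth]
  rw [setLIntegral_const, Real.volume_Ioc, sub_zero, ENNReal.ofReal_one, mul_one]

end Sections


/-! ### Step (G1): a continuous, compactly supported, `Σ`-cut-off `L²`-approximation of `F` -/

section Density

variable {k : ℕ}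

/-- The cutoff in the direction of `∑ yᵢ`: `1` when `∑ yᵢ ≤ S`, `0` when `∑ yᵢ ≥ S + κ`. [folklore] -/
def sumCutoff (S κ : ℝ) (y : Fin k → ℝ) : ℝ :=
  min 1 (max 0 ((S + κ - ∑ i, y i) / κ))

/-- The `Σ`-cutoff is continuous. [folklore] -/
theorem sumCutoff_continuous (S κ : ℝ) : Continuous (sumCutoff (k := k) S κ) := by
  unfold sumCutoff
  fun_prop

/-- The `Σ`-cutoff is `≥ 0`. [folklore] -/
theorem sumCutoff_nonneg (S κ : ℝ) (y : Fin k → ℝ) : 0 ≤ sumCutoff S κ y :=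
  le_min zero_le_one (le_max_left _ _)

/-- The `Σ`-cutoff is `≤ 1`. [folklore] -/
theorem sumCutoff_le_one (S κ : ℝ) (y : Fin k → ℝ) : sumCutoff S κ y ≤ 1 := min_le_left _ _

/-- The `Σ`-cutoff equals `1` where `∑ yᵢ ≤ S`. [folklore] -/
theorem sumCutoff_eq_one {S κ : ℝ} (hκ : 0 < κ) {y : Fin k → ℝ} (hy : ∑ i, y i ≤ S) :
    sumCutoff S κ y = 1 := by
  unfold sumCutoff
  have : 1 ≤ (S + κ - ∑ i, y i) / κ := by rw [le_div_iff₀ hκ]; linarith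
  rw [min_eq_left]
  exact le_max_of_le_right this

/-- The `Σ`-cutoff vanishes where `∑ yᵢ ≥ S + κ`. [folklore] -/
theorem sumCutoff_eq_zero {S κ : ℝ} (hκ : 0 < κ) {y : Fin k → ℝ} (hy : S + κ ≤ ∑ i, y i) :
    sumCutoff S κ y = 0 := by
  unfold sumCutoff
  have : (S + κ - ∑ i, y i) / κ ≤ 0 := div_nonpos_of_nonpos_of_nonneg (by linarith) hκ.le
  rw [max_eq_left this, min_eq_right zero_le_one]

/-- **(G1)** For a test function `F` (measurable, supported in `(1+ε) • R_k`, square-integrable)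
and `κ, η > 0` there is a continuous compactly supported `F̃`, vanishing wherever
`∑ yᵢ ≥ 1 + ε + κ`, with `∫ (F̃ - F)² ≤ η`. [cite: Polymath8b2014, §5.3, pp. 21–23] -/
theorem exists_continuous_sq_approx {ε : ℝ} {F : (Fin k → ℝ) → ℝ} (hF : IsPolymathTestFunction k ε F)
    {κ η : ℝ} (hκ : 0 < κ) (hη : 0 < η) :
    ∃ Ft : (Fin k → ℝ) → ℝ, Continuous Ft ∧ HasCompactSupport Ft ∧
      (∀ y, Ft y ≠ 0 → ∑ i, y i < 1 + ε + κ) ∧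
      Integrable (fun x => (Ft x - F x) ^ 2) ∧ ∫ x, (Ft x - F x) ^ 2 ≤ η := by
  -- `F ∈ L²`
  have hzero : ∀ x, x ∉ scaledSimplex k (1 + ε) → F x = 0 := fun x hx => by
    by_contra h; exact hx (hF.support_subset h)
  have hint : Integrable (fun x => F x ^ 2) :=
    hF.integrableOn_sq.integrable_of_forall_notMem_eq_zero fun x hx => by simp [hzero x hx]
  have hmem : MemLp F 2 volume :=
    (memLp_two_iff_integrable_sq hF.measurable.aestronglyMeasurable).2 hint
  have hmem' : MemLp F (ENNReal.ofReal 2) volume := by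
    rwa [show ENNReal.ofReal 2 = 2 by norm_num]
  obtain ⟨g, hgsupp, hgint, hgcont, hgmem⟩ :=
    hmem'.exists_hasCompactSupport_integral_rpow_sub_le (by norm_num : (0 : ℝ) < 2) hη
  have hgmem2 : MemLp g 2 volume := by rwa [show ENNReal.ofReal 2 = 2 by norm_num] at hgmem
  refine ⟨fun y => g y * sumCutoff (1 + ε) κ y, hgcont.mul (sumCutoff_continuous _ _),
    hgsupp.mul_right, fun y hy => ?_, ?_, ?_⟩
  · by_contra hge
    push Not at hge
    exact hy (show g y * sumCutoff (1 + ε) κ y = 0 by rw [sumCutoff_eq_zero hκ hge, mul_zero])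
  · -- integrability of `(F̃ - F)²` by domination with `(g - F)²`
    have hdiff : Integrable (fun x => (g x - F x) ^ 2) := by
      have := (hgmem2.sub hmem).integrable_sq
      simpa using this
    have hpt : ∀ x, (g x * sumCutoff (1 + ε) κ x - F x) ^ 2 ≤ (g x - F x) ^ 2 := fun x => by
      have hχ0 := sumCutoff_nonneg (1 + ε) κ x
      have hχ1 := sumCutoff_le_one (1 + ε) κ x
      by_cases hx : x ∈ scaledSimplex k (1 + ε)
      · rw [sumCutoff_eq_one hκ hx.2, mul_one]
      · rw [hzero x hx, sub_zero, sub_zero, mul_pow]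
        have : sumCutoff (1 + ε) κ x ^ 2 ≤ 1 := by nlinarith
        nlinarith [sq_nonneg (g x)]
    have hmeasd : AEStronglyMeasurable (fun x => (g x * sumCutoff (1 + ε) κ x - F x) ^ 2) volume :=
      (((hgcont.mul (sumCutoff_continuous _ _)).measurable.sub hF.measurable).pow_const 2)
        |>.aestronglyMeasurable
    exact hdiff.mono' hmeasd (ae_of_all _ fun x => by
      rw [Real.norm_eq_abs, abs_of_nonneg (sq_nonneg _)]; exact hpt x)
  · have hpt : ∀ x, (g x * sumCutoff (1 + ε) κ x - F x) ^ 2 ≤ (g x - F x) ^ 2 := fun x => by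
      have hχ0 := sumCutoff_nonneg (1 + ε) κ x
      have hχ1 := sumCutoff_le_one (1 + ε) κ x
      by_cases hx : x ∈ scaledSimplex k (1 + ε)
      · rw [sumCutoff_eq_one hκ hx.2, mul_one]
      · rw [hzero x hx, sub_zero, sub_zero, mul_pow]
        have : sumCutoff (1 + ε) κ x ^ 2 ≤ 1 := by nlinarith
        nlinarith [sq_nonneg (g x)]
    have hdiff : Integrable (fun x => (g x - F x) ^ 2) := by
      have := (hgmem2.sub hmem).integrable_sq
      simpa using this
    calc ∫ x, (g x * sumCutoff (1 + ε) κ x - F x) ^ 2 ≤ ∫ x, (g x - F x) ^ 2 :=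
          integral_mono_of_nonneg (ae_of_all _ fun x => sq_nonneg _) hdiff (ae_of_all _ hpt)
      _ = ∫ x, ‖F x - g x‖ ^ (2 : ℝ) := by
          refine integral_congr_ae (ae_of_all _ fun x => ?_)
          show (g x - F x) ^ 2 = ‖F x - g x‖ ^ (2 : ℝ)
          rw [Real.rpow_two, Real.norm_eq_abs, sq_abs]
          ring
      _ ≤ η := hgint

end Density


/-! ### Step (H): `I(F)` and `J_i(F)` as integrals over the boxes -/

section Regions

variable {k : ℕ}

/-- The coordinate hyperplanes `{x | xᵢ = 0}` form a null set. [folklore] -/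
theorem volume_iUnion_hyperplane_zero (k : ℕ) :
    volume (⋃ i : Fin k, {x : Fin k → ℝ | x i = 0}) = 0 :=
  measure_iUnion_null fun i => by
    rw [volume_pi]; exact Measure.pi_hyperplane _ i 0

/-- **`I(F) = ∫_{(0,R]^k} F²`** for a test function and `R ≥ 1 + ε`. [folklore] -/
theorem polymathI_eq_integral_ioBox {ε : ℝ} {F : (Fin k → ℝ) → ℝ} (hF : IsPolymathTestFunction k ε F)
    {R : ℝ} (hR : 1 + ε ≤ R) : polymathI k F = ∫ x in ioBox k R, F x ^ 2 := by
  have hzero : ∀ x, x ∉ scaledSimplex k (1 + ε) → F x = 0 := fun x hx => by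
    by_contra h; exact hx (hF.support_subset h)
  unfold polymathI
  rw [setIntegral_eq_integral_of_forall_compl_eq_zero fun x hx => by
    rw [hzero x fun h => hx h.1, zero_pow two_ne_zero]]
  symm
  refine setIntegral_eq_integral_of_ae_compl_eq_zero ?_
  have hN := volume_iUnion_hyperplane_zero k
  rw [← compl_mem_ae_iff] at hN
  filter_upwards [hN] with x hxN hx
  rw [hzero x fun hsim => hx ?_, zero_pow two_ne_zero]
  -- `x` in the simplex and off the hyperplanes lies in the box
  simp only [Set.mem_compl_iff, Set.mem_iUnion, Set.mem_setOf_eq, not_exists] at hxN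
  refine Set.mem_univ_pi.2 fun i => ⟨lt_of_le_of_ne (hsim.1 i) (Ne.symm (hxN i)), ?_⟩
  have : x i ≤ ∑ j, x j := Finset.single_le_sum (fun j _ => hsim.1 j) (Finset.mem_univ i)
  linarith [hsim.2]

/-- **`J_i(F) = ∫_{betaBox ∩ {∑_{j≠i} xⱼ ≤ 1-ε}} (M⁺F)²`**: the printed region and the half-open box
region differ by a null set. [folklore] -/
theorem polymathJ_eq_integral_betaBox {ε : ℝ} (hε : 0 ≤ ε) (F : (Fin k → ℝ) → ℝ) {R : ℝ}
    (hR : 1 ≤ R) (i : Fin k) :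
    polymathJ k (1 - ε) i F = ∫ x in betaBox k R i ∩ {x | ∑ j ∈ univ.erase i, x j ≤ 1 - ε},
      (∫ u in Set.Ioi (0 : ℝ), F (Function.update x i u)) ^ 2 := by
  unfold polymathJ
  refine setIntegral_congr_set ?_
  -- `JRegion =ᵐ betaBox ∩ A'`
  have hN := volume_iUnion_hyperplane_zero k
  rw [← compl_mem_ae_iff] at hN
  filter_upwards [hN] with x hxN
  simp only [Set.mem_compl_iff, Set.mem_iUnion, Set.mem_setOf_eq, not_exists] at hxN
  apply propext
  constructor
  · rintro ⟨h1, h2, h3⟩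
    refine ⟨Set.mem_univ_pi.2 fun j => ?_, h3⟩
    have hpos : 0 < x j := lt_of_le_of_ne (h2 j) (Ne.symm (hxN j))
    by_cases hj : j = i
    · subst hj; simp only [↓reduceIte]; exact ⟨hpos, h1⟩
    · simp only [hj, ↓reduceIte]
      refine ⟨hpos, ?_⟩
      have : x j ≤ ∑ j' ∈ univ.erase i, x j' :=
        Finset.single_le_sum (fun j' _ => h2 j') (Finset.mem_erase.2 ⟨hj, Finset.mem_univ j⟩)
      linarith
  · rintro ⟨hb, h3⟩
    rw [betaBox, Set.mem_univ_pi] at hb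
    refine ⟨?_, fun j => ?_, h3⟩
    · have := hb i; rw [if_pos rfl] at this; exact this.2
    · have := hb j
      by_cases hj : j = i
      · subst hj; rw [if_pos rfl] at this; exact this.1.le
      · rw [if_neg hj] at this; exact this.1.le

end Regions


/-! ### Step (F2b): sections of `L¹`/`L²` functions and the marginal bound -/

section MarginalBound

variable {n : ℕ}

/-- **a.e. sections are integrable**: if `Φ` is integrable on `ℝ^{n+1}`, then for a.e. `x` the
section `u ↦ Φ(update x i u)` is integrable on `ℝ`. [folklore] -/
theorem ae_integrable_section (i : Fin (n + 1)) {Φ : (Fin (n + 1) → ℝ) → ℝ} (hΦ : Integrable Φ) :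
    ∀ᵐ x : Fin (n + 1) → ℝ, Integrable fun u : ℝ => Φ (Function.update x i u) := by
  have hE := splitEquiv_measurePreserving (n := n) i
  -- integrability of `Φ ∘ e.symm` on the product
  have h1 : Integrable (fun p : ℝ × (Fin n → ℝ) => Φ ((splitEquiv n i).symm p))
      ((volume : Measure ℝ).prod volume) := by
    have := (hE.symm.integrable_comp_emb (splitEquiv n i).symm.measurableEmbedding (g := Φ)).2 hΦ
    rw [Measure.volume_eq_prod] at this
    exact this
  have h2 := h1.prod_left_ae
  -- `h2 : ∀ᵐ y, Integrable (fun u => Φ (insertNth i u y))`; transport to `x`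
  have h3 : volume {x : Fin (n + 1) → ℝ | ¬Integrable fun u : ℝ => Φ (Function.update x i u)} = 0 := by
    have hsub : {x : Fin (n + 1) → ℝ | ¬Integrable fun u : ℝ => Φ (Function.update x i u)} ⊆
        splitEquiv n i ⁻¹' (Set.univ ×ˢ {y : Fin n → ℝ |
          ¬Integrable fun u : ℝ => Φ ((splitEquiv n i).symm (u, y))}) := by
      intro x hx
      simp only [Set.mem_preimage, Set.mem_prod, Set.mem_univ, true_and, Set.mem_setOf_eq]
      convert hx using 2
      funext u
      show Φ (Fin.insertNth i u (Fin.removeNth i x)) = Φ (Function.update x i u)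
      rw [Fin.insertNth_removeNth]
    refine measure_mono_null hsub ?_
    rw [hE.measure_preimage_equiv, Measure.volume_eq_prod, Measure.prod_prod]
    rw [ae_iff] at h2
    rw [h2, mul_zero]
  rw [ae_iff]
  exact h3

/-- **Jensen in the `u`-variable**: `(∫_{(0,T]} |f|)² ≤ T ∫_{(0,T]} f²` for `f²` integrable. [folklore] -/
theorem sq_setIntegral_abs_le {T : ℝ} (hT : 0 < T) {f : ℝ → ℝ}
    (hf : IntegrableOn f (Set.Ioc 0 T)) (hf2 : IntegrableOn (fun u => f u ^ 2) (Set.Ioc 0 T)) :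
    (∫ u in Set.Ioc 0 T, |f u|) ^ 2 ≤ T * ∫ u in Set.Ioc 0 T, f u ^ 2 := by
  have hvol : volume (Set.Ioc 0 T) = ENNReal.ofReal T := by rw [Real.volume_Ioc, sub_zero]
  have h0 : volume (Set.Ioc (0 : ℝ) T) ≠ 0 := by rw [hvol]; exact (ENNReal.ofReal_pos.2 hT).ne'
  have htop : volume (Set.Ioc (0 : ℝ) T) ≠ ⊤ := by rw [hvol]; exact ENNReal.ofReal_ne_top
  have hcomp : ((fun x : ℝ => x ^ 2) ∘ fun a => |f a|) = fun u => f u ^ 2 := by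
    funext u; simp [sq_abs]
  have hJ := ConvexOn.map_set_average_le (Even.convexOn_pow (n := 2) even_two)
    (continuous_pow 2).continuousOn isClosed_univ h0 htop (ae_of_all _ fun u => Set.mem_univ _)
    hf.abs (by rw [hcomp]; exact hf2)
  -- `hJ : (⨍ |f|)² ≤ ⨍ |f|²`
  simp only [sq_abs] at hJ
  rw [setAverage_eq, setAverage_eq, smul_eq_mul, smul_eq_mul, Measure.real, hvol,
    ENNReal.toReal_ofReal hT.le] at hJ
  have hT' : T ≠ 0 := hT.ne'
  have : (T⁻¹ * ∫ u in Set.Ioc 0 T, |f u|) ^ 2 = T⁻¹ ^ 2 * (∫ u in Set.Ioc 0 T, |f u|) ^ 2 := by ring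
  rw [this] at hJ
  have h3 : (∫ u in Set.Ioc 0 T, |f u|) ^ 2 = T ^ 2 * (T⁻¹ ^ 2 * (∫ u in Set.Ioc 0 T, |f u|) ^ 2) := by
    field_simp
  rw [h3]
  calc T ^ 2 * (T⁻¹ ^ 2 * (∫ u in Set.Ioc 0 T, |f u|) ^ 2)
      ≤ T ^ 2 * (T⁻¹ * ∫ u in Set.Ioc 0 T, f u ^ 2) :=
        mul_le_mul_of_nonneg_left hJ (sq_nonneg T)
    _ = T * ∫ u in Set.Ioc 0 T, f u ^ 2 := by field_simp

end MarginalBound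


section MarginalBound2

variable {n : ℕ}

/-- An integrable function on `(0, ∞)` vanishing beyond `T ≥ 0`: `∫_{u>0} g = ∫_{(0,T]} g`. [folklore] -/
theorem setIntegral_Ioi_eq_Ioc_of_eq_zero {g : ℝ → ℝ} {T : ℝ} (hT : 0 ≤ T)
    (hg : IntegrableOn g (Set.Ioc 0 T)) (h0 : ∀ u, T < u → g u = 0) :
    ∫ u in Set.Ioi 0, g u = ∫ u in Set.Ioc 0 T, g u := by
  have hz : ∫ u in Set.Ioi T, g u = 0 :=
    (setIntegral_congr_fun measurableSet_Ioi (g := fun _ => (0 : ℝ)) fun u hu => h0 u hu).trans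
      (by simp)
  rw [← Set.Ioc_union_Ioi_eq_Ioi hT, setIntegral_union (Set.Ioc_disjoint_Ioi le_rfl)
    measurableSet_Ioi hg ?_, hz, add_zero]
  exact integrableOn_zero.congr_fun (fun u hu => (h0 u hu).symm) measurableSet_Ioi

/-- `sideBox R T ⊆ (0, R]^k` for `T ≤ R`. [folklore] -/
theorem sideBox_subset_ioBox {R T : ℝ} (hT : T ≤ R) (i : Fin (n + 1)) :
    sideBox (n + 1) R T i ⊆ ioBox (n + 1) R := by
  intro x hx
  rw [sideBox, Set.mem_univ_pi] at hx
  refine Set.mem_univ_pi.2 fun j => ?_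
  have := hx j
  by_cases hj : j = i
  · rw [if_pos hj] at this; exact ⟨this.1, this.2.trans hT⟩
  · rw [if_neg hj] at this; exact this

/-- **The marginal bound (Polymath 8b §5.1 "by continuity", made quantitative)**: for `F ∈ L¹ ∩ L²`
and a continuous `G`, both with `u`-sections along `i` vanishing for `u > 2`, writing
`a = M⁺G` (given as a continuous function) and `b = M⁺F`,
`∫_Q b² ≤ (1 + τ) ∫_Q a² + (1 + 1/τ) · 4 ∫_{ioBox} (G - F)²` for every `τ > 0` (no sup-norm bound
on `a` is needed: `b² = (a - d)² ≤ (1+τ) a² + (1 + 1/τ) d²`). [cite: Polymath8b2014, §5.3, pp. 21–23] -/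
theorem marginal_sq_bound (i : Fin (n + 1)) {R : ℝ} (hR : 2 ≤ R) {F G : (Fin (n + 1) → ℝ) → ℝ}
    (hFm : Measurable F) (hGc : Continuous G) (hF1 : Integrable F)
    (hF2 : Integrable fun x => F x ^ 2)
    (hFz : ∀ x u, 2 < u → F (Function.update x i u) = 0)
    (hGz : ∀ x u, 2 < u → G (Function.update x i u) = 0)
    {a : (Fin (n + 1) → ℝ) → ℝ} (hac : Continuous a)
    (hGa : ∀ x, ∫ u in Set.Ioi 0, G (Function.update x i u) = a x)
    {Q : Set (Fin (n + 1) → ℝ)} (hQ : Q ⊆ betaBox (n + 1) R i) (hQm : MeasurableSet Q)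
    {τ : ℝ} (hτ : 0 < τ) :
    ∫ x in Q, (∫ u in Set.Ioi 0, F (Function.update x i u)) ^ 2 ≤
      (1 + τ) * (∫ x in Q, a x ^ 2) +
        (1 + 1 / τ) * (2 * (2 * ∫ x in ioBox (n + 1) R, (G x - F x) ^ 2)) := by
  classical
  have hR1 : (1 : ℝ) ≤ R := by linarith
  have hvolQ : volume Q < ⊤ :=
    lt_of_le_of_lt (measure_mono (hQ.trans (betaBox_subset_Icc hR1 i))) measure_Icc_lt_top
  have hDm : Measurable fun x => G x - F x := hGc.measurable.sub hFm
  -- the `ℝ≥0∞`-valued section functional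
  set H : (Fin (n + 1) → ℝ) → ENNReal := fun x =>
    ∫⁻ u in Set.Ioc 0 2, ENNReal.ofReal ((G (Function.update x i u) - F (Function.update x i u)) ^ 2) with hH
  have hHm : Measurable H := by
    refine Measurable.lintegral_prod_right
      (f := fun x u => ENNReal.ofReal ((G (Function.update x i u) - F (Function.update x i u)) ^ 2)) ?_
    exact ((hDm.comp measurable_update').pow_const 2).ennreal_ofReal
  -- `∫⁻_{betaBox} H = ∫⁻_{sideBox R 2} ofReal D² ≤ ofReal ∫_{ioBox} D² < ∞`
  have hD2int : IntegrableOn (fun x => (G x - F x) ^ 2) (ioBox (n + 1) R) := by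
    have h1 : IntegrableOn (fun x => 2 * G x ^ 2 + 2 * F x ^ 2) (ioBox (n + 1) R) :=
      (integrableOn_ioBox_of_continuous (by fun_prop : Continuous fun x => 2 * G x ^ 2) R).add
        ((hF2.const_mul 2).integrableOn)
    refine h1.mono' ((hDm.pow_const 2).aestronglyMeasurable) (ae_of_all _ fun x => ?_)
    rw [Real.norm_eq_abs, abs_of_nonneg (sq_nonneg _)]
    nlinarith [sq_nonneg (G x + F x)]
  have hlin : ∫⁻ x in betaBox (n + 1) R i, H x ≤
      ENNReal.ofReal (∫ x in ioBox (n + 1) R, (G x - F x) ^ 2) := by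
    rw [hH, lintegral_betaBox_section R 2 i ((hDm.pow_const 2).ennreal_ofReal),
      ofReal_integral_eq_lintegral_ofReal hD2int (ae_of_all _ fun x => sq_nonneg _)]
    exact lintegral_mono_set (sideBox_subset_ioBox hR i)
  have hlt : ∫⁻ x in betaBox (n + 1) R i, H x < ⊤ := lt_of_le_of_lt hlin ENNReal.ofReal_lt_top
  have hHint : IntegrableOn (fun x => (H x).toReal) (betaBox (n + 1) R i) :=
    integrable_toReal_of_lintegral_ne_top hHm.aemeasurable hlt.ne
  have hHint_le : ∫ x in betaBox (n + 1) R i, (H x).toReal ≤ ∫ x in ioBox (n + 1) R, (G x - F x) ^ 2 := by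
    rw [integral_toReal hHm.aemeasurable (ae_lt_top hHm hlt.ne)]
    have := ENNReal.toReal_mono ENNReal.ofReal_ne_top hlin
    rwa [ENNReal.toReal_ofReal (integral_nonneg fun x => sq_nonneg _)] at this
  -- a.e. sections of `F` and `F²` are integrable
  have hae1 := ae_integrable_section i hF1
  have hae2 := ae_integrable_section i hF2
  set s := 1 / τ with hs
  have hsτ : s * τ = 1 := by rw [hs]; field_simp
  have hs0 : 0 ≤ s := by positivity
  -- pointwise bound for good `x ∈ Q`
  have hpt : ∀ᵐ x : Fin (n + 1) → ℝ, x ∈ Q →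
      (∫ u in Set.Ioi 0, F (Function.update x i u)) ^ 2 ≤
        (1 + τ) * a x ^ 2 + (1 + s) * (2 * (2 * (H x).toReal)) := by
    filter_upwards [hae1, hae2] with x hx1 hx2 hxQ
    have hGsec : Continuous fun u : ℝ => G (Function.update x i u) := hGc.comp (by fun_prop)
    have hGz' : ∀ u, 2 ≤ u → G (Function.update x i u) = 0 := by
      have hsub : Set.Ici (2 : ℝ) ⊆ {u | G (Function.update x i u) = 0} := by
        rw [← closure_Ioi]
        exact closure_minimal (fun u hu => hGz x u hu) (isClosed_eq hGsec continuous_const)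
      exact fun u hu => hsub hu
    have hGint : IntegrableOn (fun u => G (Function.update x i u)) (Set.Ioi 0) :=
      integrableOn_Ioi_of_eq_zero hGsec zero_le_two hGz'
    have hFint : IntegrableOn (fun u => F (Function.update x i u)) (Set.Ioi 0) := hx1.integrableOn
    have hDint : IntegrableOn (fun u => (G (Function.update x i u) - F (Function.update x i u))) (Set.Ioi 0) := hGint.sub hFint
    -- `b = a - d`
    have hDsplit : ∫ u in Set.Ioi 0, (G (Function.update x i u) - F (Function.update x i u)) =
        a x - ∫ u in Set.Ioi 0, F (Function.update x i u) := by
      rw [← hGa x, ← integral_sub hGint hFint]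
    have hD0 : ∀ u, 2 < u → (G (Function.update x i u) - F (Function.update x i u)) = 0 := fun u hu => by
      rw [hGz x u hu, hFz x u hu, sub_zero]
    have hdIoc : IntegrableOn (fun u => (G (Function.update x i u) - F (Function.update x i u))) (Set.Ioc 0 2) :=
      hDint.mono_set Set.Ioc_subset_Ioi_self
    have hd2Ioc : IntegrableOn (fun u => (G (Function.update x i u) - F (Function.update x i u)) ^ 2) (Set.Ioc 0 2) := by
      have hG2 : IntegrableOn (fun u => 2 * G (Function.update x i u) ^ 2 +
          2 * F (Function.update x i u) ^ 2) (Set.Ioc 0 2) :=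
        ((by fun_prop : Continuous fun u => 2 * G (Function.update x i u) ^ 2).integrableOn_Ioc).add
          (hx2.integrableOn.const_mul 2)
      refine hG2.mono'
        (((hDm.comp (measurable_update (f := x) (a := i))).pow_const 2).aestronglyMeasurable)
        (ae_of_all _ fun u => ?_)
      rw [Real.norm_eq_abs, abs_of_nonneg (sq_nonneg _)]
      nlinarith [sq_nonneg (G (Function.update x i u) + F (Function.update x i u))]
    have hdeq : ∫ u in Set.Ioi 0, (G (Function.update x i u) - F (Function.update x i u)) =
        ∫ u in Set.Ioc 0 2, (G (Function.update x i u) - F (Function.update x i u)) :=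
      setIntegral_Ioi_eq_Ioc_of_eq_zero zero_le_two hdIoc hD0
    set d := ∫ u in Set.Ioc 0 2, (G (Function.update x i u) - F (Function.update x i u)) with hd
    have hdabs : |d| ≤ ∫ u in Set.Ioc 0 2, |(G (Function.update x i u) - F (Function.update x i u))| := by
      have := norm_integral_le_integral_norm (μ := volume.restrict (Set.Ioc 0 2))
        (fun u => (G (Function.update x i u) - F (Function.update x i u)))
      simpa only [Real.norm_eq_abs] using this
    have hJ := sq_setIntegral_abs_le zero_lt_two hdIoc hd2Ioc
    have hHx : ∫ u in Set.Ioc 0 2, (G (Function.update x i u) - F (Function.update x i u)) ^ 2 = (H x).toReal := by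
      simp only [hH]
      rw [← ofReal_integral_eq_lintegral_ofReal hd2Ioc (ae_of_all _ fun u => sq_nonneg _),
        ENNReal.toReal_ofReal (integral_nonneg fun u => sq_nonneg _)]
    have hd2 : d ^ 2 ≤ 2 * (H x).toReal := by
      rw [← hHx]
      calc d ^ 2 = |d| ^ 2 := by rw [sq_abs]
        _ ≤ (∫ u in Set.Ioc 0 2, |(G (Function.update x i u) - F (Function.update x i u))|) ^ 2 :=
            pow_le_pow_left₀ (abs_nonneg _) hdabs 2
        _ ≤ 2 * ∫ u in Set.Ioc 0 2, (G (Function.update x i u) - F (Function.update x i u)) ^ 2 := hJ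
    -- conclude
    have hb : ∫ u in Set.Ioi 0, F (Function.update x i u) = a x - d := by
      linarith [hDsplit, hdeq]
    rw [hb]
    -- AM–GM: `-2ad ≤ τ a² + d²/τ`
    have hAM : -(2 * a x * d) ≤ τ * a x ^ 2 + s * d ^ 2 := by
      have h1 : 0 ≤ (τ * a x + d) ^ 2 := sq_nonneg _
      have h2 : s * (τ * a x + d) ^ 2 = τ * (s * τ) * a x ^ 2 + 2 * (s * τ) * a x * d + s * d ^ 2 := by
        ring
      rw [hsτ] at h2
      nlinarith [mul_nonneg hs0 h1]
    have hH0 : 0 ≤ (H x).toReal := ENNReal.toReal_nonneg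
    nlinarith [hd2, hAM]
  -- integrate over `Q`
  have hi1 : IntegrableOn (fun x => (1 + τ) * a x ^ 2) Q :=
    ((integrableOn_betaBox_of_continuous (hac.pow 2) hR1 i).mono_set hQ).const_mul _
  have hi3 : IntegrableOn (fun x => (1 + s) * (2 * (2 * (H x).toReal))) Q :=
    (((hHint.mono_set hQ).const_mul 2).const_mul 2).const_mul _
  have hi13 : IntegrableOn (fun x => (1 + τ) * a x ^ 2 + (1 + s) * (2 * (2 * (H x).toReal))) Q :=
    hi1.add hi3
  have hQle : ∫ x in Q, (H x).toReal ≤ ∫ x in ioBox (n + 1) R, (G x - F x) ^ 2 :=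
    (setIntegral_mono_set hHint (ae_of_all _ fun x => ENNReal.toReal_nonneg)
      (ae_of_all _ hQ)).trans hHint_le
  have hC : 0 ≤ 1 + s := by positivity
  have hI0 : 0 ≤ ∫ x in ioBox (n + 1) R, (G x - F x) ^ 2 := integral_nonneg fun x => sq_nonneg _
  by_cases hb : IntegrableOn (fun x => (∫ u in Set.Ioi 0, F (Function.update x i u)) ^ 2) Q
  · calc ∫ x in Q, (∫ u in Set.Ioi 0, F (Function.update x i u)) ^ 2
        ≤ ∫ x in Q, ((1 + τ) * a x ^ 2 + (1 + s) * (2 * (2 * (H x).toReal))) :=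
          setIntegral_mono_ae_restrict hb hi13 ((ae_restrict_iff' hQm).2 hpt)
      _ = (1 + τ) * (∫ x in Q, a x ^ 2) + (1 + s) * (2 * (2 * ∫ x in Q, (H x).toReal)) := by
          rw [integral_add hi1 hi3]
          simp only [integral_const_mul]
      _ ≤ (1 + τ) * (∫ x in Q, a x ^ 2) +
            (1 + s) * (2 * (2 * ∫ x in ioBox (n + 1) R, (G x - F x) ^ 2)) := by
          have := mul_le_mul_of_nonneg_left
            (show 2 * (2 * ∫ x in Q, (H x).toReal) ≤ 2 * (2 * ∫ x in ioBox (n + 1) R, (G x - F x) ^ 2) by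
              linarith) hC
          linarith
  · rw [integral_undef hb]
    have h1 : 0 ≤ (1 + τ) * ∫ x in Q, a x ^ 2 :=
      mul_nonneg (by linarith) (integral_nonneg fun x => sq_nonneg _)
    have h4 : 0 ≤ (1 + s) * (2 * (2 * ∫ x in ioBox (n + 1) R, (G x - F x) ^ 2)) :=
      mul_nonneg hC (by linarith)
    linarith

end MarginalBound2


/-! ### Assembly helpers: the index set `J`, and reindexing by `Fin n` -/

section AssemblyHelpers

variable {k : ℕ}

/-- The index set of the construction: multi-indices in the box with nonnegative entries and
`∑ᵢ δ(lᵢ + 1) ≤ S₀`. [cite: Polymath8b2014, §5.3, pp. 21–23] -/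
def goodIndex (k L : ℕ) (δ S₀ : ℝ) : Finset (Fin k → ℤ) :=
  (indexBox k L).filter fun l => (∀ i, 0 ≤ l i) ∧ ∑ i, δ * ((l i : ℝ) + 1) ≤ S₀

/-- `goodIndex ⊆ indexBox`. [folklore] -/
theorem goodIndex_subset (L : ℕ) (δ S₀ : ℝ) : goodIndex k L δ S₀ ⊆ indexBox k L :=
  Finset.filter_subset _ _

/-- Indices in `goodIndex` have nonnegative entries. [folklore] -/
theorem nonneg_of_mem_goodIndex {L : ℕ} {δ S₀ : ℝ} {l : Fin k → ℤ} (hl : l ∈ goodIndex k L δ S₀)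
    (i : Fin k) : 0 ≤ l i :=
  (Finset.mem_filter.1 hl).2.1 i

/-- Indices in `goodIndex` satisfy `∑ᵢ δ(lᵢ + 1) ≤ S₀`. [folklore] -/
theorem sum_le_of_mem_goodIndex {L : ℕ} {δ S₀ : ℝ} {l : Fin k → ℤ} (hl : l ∈ goodIndex k L δ S₀) :
    ∑ i, δ * ((l i : ℝ) + 1) ≤ S₀ :=
  (Finset.mem_filter.1 hl).2.2

/-- Each term `δ(lᵢ + 1)` of an index in `goodIndex` is at most `S₀`. [folklore] -/
theorem term_le_of_mem_goodIndex {L : ℕ} {δ S₀ : ℝ} (hδ : 0 ≤ δ) {l : Fin k → ℤ}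
    (hl : l ∈ goodIndex k L δ S₀) (i : Fin k) : δ * ((l i : ℝ) + 1) ≤ S₀ := by
  refine le_trans ?_ (sum_le_of_mem_goodIndex hl)
  refine Finset.single_le_sum (f := fun j => δ * ((l j : ℝ) + 1)) (fun j _ => ?_) (Finset.mem_univ i)
  have : (0 : ℝ) ≤ (l j : ℝ) := by exact_mod_cast nonneg_of_mem_goodIndex hl j
  positivity

/-- **`G = quasi-interpolant on the closed orthant`**: dropping the indices outside `goodIndex` does
not change the tensor sum at points with nonnegative coordinates, provided `Φ` vanishes wherever
`∑ yᵢ ≥ S₀ - kδ`. [cite: Polymath8b2014, §5.3, pp. 21–23] -/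
theorem tensorSum_goodIndex_eq_quasiInterp {δ : ℝ} (hδ : 0 < δ) (L : ℕ) {S₀ : ℝ}
    {Φ : (Fin k → ℝ) → ℝ} (hΦ : ∀ y, Φ y ≠ 0 → ∑ i, y i < S₀ - k * δ) {x : Fin k → ℝ}
    (hx : ∀ i, 0 ≤ x i) :
    tensorSum δ (goodIndex k L δ S₀) (fun l => Φ fun i => δ * l i) x = quasiInterp δ L Φ x := by
  unfold tensorSum quasiInterp goodIndex
  rw [← Finset.sum_filter_add_sum_filter_not (indexBox k L)
    (fun l : Fin k → ℤ => (∀ i, 0 ≤ l i) ∧ ∑ i, δ * ((l i : ℝ) + 1) ≤ S₀)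
    (fun l => Φ (fun i => δ * l i) * tensorBump δ l x)]
  symm
  rw [add_eq_left]
  refine Finset.sum_eq_zero fun l hl => ?_
  have hnot := (Finset.mem_filter.1 hl).2
  rw [not_and_or] at hnot
  rcases hnot with h1 | h2
  · push Not at h1
    obtain ⟨i, hi⟩ := h1
    rw [tensorBump_eq_zero (i := i) ?_, mul_zero]
    have hli : (l i : ℝ) ≤ -1 := by exact_mod_cast (show l i ≤ -1 by omega)
    have : 0 ≤ x i / δ := div_nonneg (hx i) hδ.le
    rw [le_abs]; left; linarith
  · push Not at h2
    have hΦ0 : Φ (fun i => δ * l i) = 0 := by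
      by_contra hne
      have hlt := hΦ _ hne
      have hsum : ∑ i, δ * ((l i : ℝ) + 1) = ∑ i, δ * (l i : ℝ) + k * δ := by
        simp only [mul_add, mul_one, Finset.sum_add_distrib, Finset.sum_const, Finset.card_univ,
          Fintype.card_fin, nsmul_eq_mul]
      have : ∑ i, δ * ((l i : ℝ) + 1) < S₀ := by rw [hsum]; linarith
      linarith
    rw [hΦ0, zero_mul]

/-- The `u`-sections of `G` along `i` vanish for `u ≥ S₀`. [cite: Polymath8b2014, §5.3, pp. 21–23] -/
theorem tensorSum_update_eq_zero {δ : ℝ} (hδ : 0 < δ) {L : ℕ} {S₀ : ℝ} (c : (Fin k → ℤ) → ℝ)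
    (x : Fin k → ℝ) (i : Fin k) {u : ℝ} (hu : S₀ ≤ u) :
    tensorSum δ (goodIndex k L δ S₀) c (Function.update x i u) = 0 := by
  unfold tensorSum
  refine Finset.sum_eq_zero fun l hl => ?_
  rw [tensorBump_update, pouBump_div_sub_eq_zero_of_le hδ ((term_le_of_mem_goodIndex hδ.le hl i).trans hu)]
  ring

/-- **Reindexing by `Fin n`**: the data over a `Finset` of an arbitrary index type yield the
`Fin n`-indexed data required by `exists_tensorCutoffs_of_polymathFunctional_gt`. [folklore] -/
theorem exists_fin_reindex {ι : Type*} [DecidableEq ι] (J : Finset ι) (c : ι → ℝ)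
    (f : Fin k → ι → ℝ → ℝ) (s : Fin k → ι → ℝ) (m t₁ t₂ : ℝ)
    (h1 : ∀ i, ∀ j ∈ J, IsSieveCutoff (f i j) (s i j)) (h2 : ∀ j ∈ J, ∑ i, s i j < t₁)
    (h3 : m * tensorAlpha J c f <
      ∑ i₀, tensorBeta J c f (fun i₁ => J.filter fun j => ∑ i ∈ univ.erase i₁, s i j < t₂) i₀) :
    ∃ (n : ℕ) (c' : Fin n → ℝ) (f' : Fin k → Fin n → ℝ → ℝ) (s' : Fin k → Fin n → ℝ),
      (∀ i j, IsSieveCutoff (f' i j) (s' i j)) ∧ (∀ j, ∑ i, s' i j < t₁) ∧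
      m * tensorAlpha univ c' f' <
        ∑ i₀, tensorBeta univ c' f'
          (fun i₁ => univ.filter fun j => ∑ i ∈ univ.erase i₁, s' i j < t₂) i₀ := by
  classical
  set n := J.card
  set e : Fin n ≃ J := J.equivFin.symm with he
  refine ⟨n, fun j => c (e j), fun i j => f i (e j), fun i j => s i (e j),
    fun i j => h1 i _ (e j).2, fun j => h2 _ (e j).2, ?_⟩
  -- transport of sums along `e`
  have hsum : ∀ g : ι → ℝ, ∑ j : Fin n, g (e j) = ∑ j ∈ J, g j := fun g => by
    rw [Fintype.sum_equiv e (fun j => g (e j)) (fun x => g x) (fun _ => rfl), Finset.sum_coe_sort]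
  have hsumf : ∀ (g : ι → ℝ) (P : ι → Prop) [DecidablePred P],
      ∑ j ∈ (univ.filter fun j : Fin n => P (e j)), g (e j) = ∑ j ∈ J.filter P, g j := by
    intro g P _
    rw [Finset.sum_filter, Finset.sum_filter, hsum (fun j => if P j then g j else 0)]
  -- `α`
  set g₂ : ι → ι → ℝ := fun x y =>
    c x * c y * ∏ i, ∫ t in (0 : ℝ)..1, deriv (f i x) t * deriv (f i y) t with hg₂
  have hA : tensorAlpha univ (fun j => c (e j)) (fun i j => f i (e j)) = tensorAlpha J c f := by
    show (∑ j : Fin n, ∑ j' : Fin n, g₂ (e j) (e j')) = ∑ x ∈ J, ∑ y ∈ J, g₂ x y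
    rw [Finset.sum_congr rfl fun j _ => hsum (g₂ (e j))]
    exact hsum (fun x => ∑ y ∈ J, g₂ x y)
  -- `β`
  have hB : ∀ i₀ : Fin k,
      tensorBeta univ (fun j => c (e j)) (fun i j => f i (e j))
        (fun i₁ => univ.filter fun j => ∑ i ∈ univ.erase i₁, s i (e j) < t₂) i₀ =
      tensorBeta J c f (fun i₁ => J.filter fun j => ∑ i ∈ univ.erase i₁, s i j < t₂) i₀ := by
    intro i₀
    set P : ι → Prop := fun x => ∑ i ∈ univ.erase i₀, s i x < t₂ with hP
    set g₃ : ι → ι → ℝ := fun x y => (if P x then (1 : ℝ) else 2) * (c x * c y) *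
      (f i₀ x 0 * f i₀ y 0) *
        ∏ i ∈ univ.erase i₀, ∫ t in (0 : ℝ)..1, deriv (f i x) t * deriv (f i y) t with hg₃
    have lhs : tensorBeta univ (fun j => c (e j)) (fun i j => f i (e j))
        (fun i₁ => univ.filter fun j => ∑ i ∈ univ.erase i₁, s i (e j) < t₂) i₀ =
        ∑ j : Fin n, ∑ j' ∈ (univ.filter fun j' : Fin n => P (e j')), g₃ (e j) (e j') := by
      unfold tensorBeta
      refine Finset.sum_congr rfl fun j _ => Finset.sum_congr rfl fun j' _ => ?_
      simp only [hg₃, hP, Finset.mem_filter, Finset.mem_univ, true_and]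
    have rhs : tensorBeta J c f (fun i₁ => J.filter fun j => ∑ i ∈ univ.erase i₁, s i j < t₂) i₀ =
        ∑ x ∈ J, ∑ y ∈ J.filter P, g₃ x y := by
      unfold tensorBeta
      refine Finset.sum_congr rfl fun x hx => Finset.sum_congr rfl fun y _ => ?_
      simp only [hg₃, hP, Finset.mem_filter, hx, true_and]
    rw [lhs, rhs, Finset.sum_congr rfl fun j _ => hsumf (g₃ (e j)) P]
    exact hsum (fun x => ∑ y ∈ J.filter P, g₃ x y)
  rw [hA, Finset.sum_congr rfl fun i₀ _ => hB i₀]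
  exact h3

end AssemblyHelpers


/-! ### Assembly, step 1: the `L²` error `Δ = ∫_{ioBox} (G - F)²` and the bound for `α` -/

section AssemblyAlpha

variable {k : ℕ}

/-- A test function is square-integrable on the whole space (it vanishes off the simplex). [folklore] -/
theorem integrable_sq_of_isPolymathTestFunction {ε : ℝ} {F : (Fin k → ℝ) → ℝ}
    (hF : IsPolymathTestFunction k ε F) : Integrable fun x => F x ^ 2 :=
  hF.integrableOn_sq.integrable_of_forall_notMem_eq_zero fun x hx => by
    have : F x = 0 := by by_contra h; exact hx (hF.support_subset h)
    simp [this]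

/-- `vol((0, R]^k) = R^k`. [folklore] -/
theorem volume_ioBox_toReal {R : ℝ} (hR : 0 ≤ R) : (volume (ioBox k R)).toReal = R ^ k := by
  unfold ioBox
  rw [volume_pi_pi]
  simp [Real.volume_Ioc, ENNReal.toReal_ofReal hR]

/-- **(C)** `Δ ≤ 2 ω² R^k + 2η` when `|G - F̃| ≤ ω` on the box and `∫ (F̃ - F)² ≤ η`. [cite: Polymath8b2014, §5.3, pp. 21–23] -/
theorem sq_error_le {R : ℝ} (hR : 0 ≤ R) {G Ft F : (Fin k → ℝ) → ℝ} (hG : Continuous G)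
    (hFt : Continuous Ft) (hFm : Measurable F)
    (hdiff : Integrable fun x => (Ft x - F x) ^ 2) {w η : ℝ}
    (happrox : ∀ x ∈ ioBox k R, |G x - Ft x| ≤ w) (hη : ∫ x, (Ft x - F x) ^ 2 ≤ η) :
    IntegrableOn (fun x => (G x - F x) ^ 2) (ioBox k R) ∧
      ∫ x in ioBox k R, (G x - F x) ^ 2 ≤ 2 * w ^ 2 * R ^ k + 2 * η := by
  have hvol : volume (ioBox k R) < ⊤ :=
    lt_of_le_of_lt (measure_mono (ioBox_subset_Icc R)) measure_Icc_lt_top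
  have h1 : IntegrableOn (fun x => (G x - Ft x) ^ 2) (ioBox k R) :=
    integrableOn_ioBox_of_continuous ((hG.sub hFt).pow 2) R
  have h2 : IntegrableOn (fun x => (Ft x - F x) ^ 2) (ioBox k R) := hdiff.integrableOn
  have hpt : ∀ x, (G x - F x) ^ 2 ≤ 2 * (G x - Ft x) ^ 2 + 2 * (Ft x - F x) ^ 2 := fun x => by
    nlinarith [sq_nonneg (G x - Ft x - (Ft x - F x))]
  have hint : IntegrableOn (fun x => (G x - F x) ^ 2) (ioBox k R) := by
    refine ((h1.const_mul 2).add (h2.const_mul 2)).mono'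
      (((hG.measurable.sub hFm).pow_const 2).aestronglyMeasurable) (ae_of_all _ fun x => ?_)
    rw [Real.norm_eq_abs, abs_of_nonneg (sq_nonneg _)]
    exact hpt x
  refine ⟨hint, ?_⟩
  have h1' : IntegrableOn (fun x => 2 * (G x - Ft x) ^ 2) (ioBox k R) := h1.const_mul 2
  have h2' : IntegrableOn (fun x => 2 * (Ft x - F x) ^ 2) (ioBox k R) := h2.const_mul 2
  have h12 : IntegrableOn (fun x => 2 * (G x - Ft x) ^ 2 + 2 * (Ft x - F x) ^ 2) (ioBox k R) :=
    h1'.add h2' 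
  have hI1 : ∫ x in ioBox k R, (G x - Ft x) ^ 2 ≤ w ^ 2 * R ^ k := by
    calc ∫ x in ioBox k R, (G x - Ft x) ^ 2 ≤ ∫ x in ioBox k R, w ^ 2 :=
          setIntegral_mono_on h1 (integrableOn_const hvol.ne) (measurableSet_ioBox R) fun x hx => by
            have := happrox x hx
            rw [← sq_abs]
            exact pow_le_pow_left₀ (abs_nonneg _) this 2
      _ = w ^ 2 * R ^ k := by
          rw [setIntegral_const, smul_eq_mul, measureReal_def, volume_ioBox_toReal hR, mul_comm]
  have hI2 : ∫ x in ioBox k R, (Ft x - F x) ^ 2 ≤ η :=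
    (setIntegral_le_integral hdiff (ae_of_all _ fun x => sq_nonneg _)).trans hη
  calc ∫ x in ioBox k R, (G x - F x) ^ 2
      ≤ ∫ x in ioBox k R, (2 * (G x - Ft x) ^ 2 + 2 * (Ft x - F x) ^ 2) :=
        setIntegral_mono_on hint h12 (measurableSet_ioBox R) fun x _ => hpt x
    _ = 2 * (∫ x in ioBox k R, (G x - Ft x) ^ 2) + 2 * ∫ x in ioBox k R, (Ft x - F x) ^ 2 := by
        rw [integral_add h1' h2', integral_const_mul, integral_const_mul]
    _ ≤ 2 * w ^ 2 * R ^ k + 2 * η := by nlinarith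

/-- **(A)** `α ≤ ρ^k ((1+τ') I(F) + (1 + 1/τ') Δ)`. [cite: Polymath8b2014, §5.3, pp. 21–23] -/
theorem alpha_le {ε ρ δ : ℝ} (hρ : 0 < ρ) (hδ : 0 < δ) (J : Finset (Fin k → ℤ))
    (c : (Fin k → ℤ) → ℝ) {F : (Fin k → ℝ) → ℝ} (hF : IsPolymathTestFunction k ε F)
    (hR : 1 + ε ≤ 1 / ρ) (hΔ : IntegrableOn (fun x => (tensorSum δ J c x - F x) ^ 2) (ioBox k (1 / ρ)))
    {τ' : ℝ} (hτ' : 0 < τ') :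
    tensorAlpha J c (fun i l => pouCutoff ρ δ l i) ≤
      ρ ^ k * ((1 + τ') * polymathI k F +
        (1 + 1 / τ') * (∫ x in ioBox k (1 / ρ), (tensorSum δ J c x - F x) ^ 2)) := by
  rw [tensorAlpha_pouCutoff hρ hδ, polymathI_eq_integral_ioBox hF hR]
  refine mul_le_mul_of_nonneg_left ?_ (pow_nonneg hρ.le _)
  set G := tensorSum δ J c
  have hG : Continuous G := tensorSum_continuous δ J c
  have hF2 : IntegrableOn (fun x => F x ^ 2) (ioBox k (1 / ρ)) :=
    (integrable_sq_of_isPolymathTestFunction hF).integrableOn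
  have hG2 : IntegrableOn (fun x => G x ^ 2) (ioBox k (1 / ρ)) :=
    integrableOn_ioBox_of_continuous (hG.pow 2) _
  have hs : 0 < 1 / τ' := by positivity
  have hpt : ∀ x, G x ^ 2 ≤ (1 + τ') * F x ^ 2 + (1 + 1 / τ') * (G x - F x) ^ 2 := fun x => by
    have h1 : 0 ≤ (τ' * F x - (G x - F x)) ^ 2 := sq_nonneg _
    have h2 : (1 / τ') * (τ' * F x - (G x - F x)) ^ 2 =
        τ' * F x ^ 2 - 2 * F x * (G x - F x) + (1 / τ') * (G x - F x) ^ 2 := by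
      field_simp
      ring
    nlinarith [mul_nonneg hs.le h1]
  have hF2' : IntegrableOn (fun x => (1 + τ') * F x ^ 2) (ioBox k (1 / ρ)) := hF2.const_mul _
  have hΔ' : IntegrableOn (fun x => (1 + 1 / τ') * (G x - F x) ^ 2) (ioBox k (1 / ρ)) := hΔ.const_mul _
  have hsum : IntegrableOn (fun x => (1 + τ') * F x ^ 2 + (1 + 1 / τ') * (G x - F x) ^ 2)
      (ioBox k (1 / ρ)) := hF2'.add hΔ'
  calc ∫ x in ioBox k (1 / ρ), G x ^ 2
      ≤ ∫ x in ioBox k (1 / ρ), ((1 + τ') * F x ^ 2 + (1 + 1 / τ') * (G x - F x) ^ 2) :=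
        setIntegral_mono_on hG2 hsum (measurableSet_ioBox _) fun x _ => hpt x
    _ = (1 + τ') * (∫ x in ioBox k (1 / ρ), F x ^ 2) +
          (1 + 1 / τ') * (∫ x in ioBox k (1 / ρ), (G x - F x) ^ 2) := by
        rw [integral_add hF2' hΔ', integral_const_mul, integral_const_mul]

end AssemblyAlpha


/-! ### Assembly, step 2: the lower bound for `β_i` -/

section AssemblyBeta

variable {n : ℕ}

/-- `Fin (n + 1)` has an element different from any given one when `n ≥ 1`. [folklore] -/
theorem exists_ne_fin (hn : 1 ≤ n) (i : Fin (n + 1)) : ∃ j : Fin (n + 1), j ≠ i := by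
  by_cases hi : (i : ℕ) = 0
  · exact ⟨⟨1, by omega⟩, fun h => by rw [← h] at hi; simp at hi⟩
  · exact ⟨⟨0, by omega⟩, fun h => by rw [← h] at hi; simp at hi⟩

/-- **(B)** The lower bound for `β_i` (Polymath 8b p. 22: `β_i = J̃_{i,(1-ε)ϑ/2}(f₄) + O(δ₃)`, made
quantitative): for the cutoffs attached to `goodIndex`,
`β_i ≥ ρ^{k+1} ( (J_i(F) - (1+1/τ)·4Δ)/(1+τ) - 8B²·2nδR^n )`. [cite: Polymath8b2014, §5.3, pp. 21–23] -/
theorem beta_ge {ε θ ρ δ : ℝ} (hε0 : 0 < ε) (hρ : 0 < ρ) (hδ : 0 < δ)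
    (h2R : 2 ≤ 1 / ρ) {L : ℕ} (hL : 1 / (ρ * δ) ≤ L) {S₀ : ℝ} (hS₀ : S₀ ≤ 2) (hn : 1 ≤ n)
    (hΛ : 1 - ε ≤ (1 - ε) * θ / (2 * ρ) - 2 * n * δ)
    (c : (Fin (n + 1) → ℤ) → ℝ) {B : ℝ} (hB0 : 0 ≤ B)
    (hB : ∀ l ∈ goodIndex (n + 1) L δ S₀, |c l| ≤ B)
    {F : (Fin (n + 1) → ℝ) → ℝ} (hF : IsPolymathTestFunction (n + 1) ε F) (hF1 : Integrable F)
    (hε2 : 1 + ε ≤ 2) {τ : ℝ} (hτ : 0 < τ) (i : Fin (n + 1)) :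
    ρ ^ (n + 1 + 1) * ((polymathJ (n + 1) (1 - ε) i F -
        (1 + 1 / τ) * (2 * (2 * ∫ x in ioBox (n + 1) (1 / ρ),
          (tensorSum δ (goodIndex (n + 1) L δ S₀) c x - F x) ^ 2))) / (1 + τ) -
        2 * (2 * B) * (2 * B) * (2 * n * δ * (1 / ρ) ^ n)) ≤
      tensorBeta (goodIndex (n + 1) L δ S₀) c (fun i l => pouCutoff ρ δ l i)
        (fun i₁ => (goodIndex (n + 1) L δ S₀).filter fun l =>
          ∑ j ∈ univ.erase i₁, ρ * δ * ((l j : ℝ) + 1) < (1 - ε) * θ / 2) i := by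
  classical
  -- names
  set R := 1 / ρ with hRdef
  set J := goodIndex (n + 1) L δ S₀ with hJ
  set J₁ : Fin (n + 1) → Finset (Fin (n + 1) → ℤ) := fun i₁ => J.filter fun l =>
    ∑ j ∈ univ.erase i₁, ρ * δ * ((l j : ℝ) + 1) < (1 - ε) * θ / 2 with hJ₁
  set J₂ := J.filter fun l => l ∉ J₁ i with hJ₂
  set Λ := (1 - ε) * θ / (2 * ρ) with hΛdef
  set G := tensorSum δ J c with hG
  set Δ := ∫ x in ioBox (n + 1) R, (G x - F x) ^ 2 with hΔdef
  set Ψ₁ := marginalSum δ R i (J₁ i) c with hΨ₁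
  set Ψ₂ := marginalSum δ R i J₂ c with hΨ₂
  set ΨJ := marginalSum δ R i J c with hΨJ
  have hρ1 : ρ ≤ 1 := by
    have : (1 : ℝ) ≤ 1 / ρ := by linarith
    rwa [le_div_iff₀ hρ, one_mul] at this
  have hR1 : (1 : ℝ) ≤ R := by simp only [hRdef]; linarith
  have hR0 : (0 : ℝ) ≤ R := by linarith
  have hk2 : 2 ≤ (n + 1) := by omega
  have hJsub : J ⊆ indexBox (n + 1) L := goodIndex_subset L δ S₀
  have hterm : ∀ l ∈ J, ∀ j, δ * ((l j : ℝ) + 1) ≤ S₀ := fun l hl j =>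
    term_le_of_mem_goodIndex hδ.le hl j
  -- Step 1: `β = ρ^{(n + 1)+1} ∫_{betaBox} (Ψ₁ + 2Ψ₂) Ψ₁`
  have hβ := tensorBeta_pouCutoff hρ hρ1 hδ J c J₁ i (Finset.filter_subset _ _) (by omega)
    (fun l hl => (hterm l hl i).trans (hS₀.trans h2R))
  rw [hβ]
  refine mul_le_mul_of_nonneg_left ?_ (pow_nonneg hρ.le _)
  -- Step 2: pointwise lower bound on `betaBox`
  have hS₁ : ∀ l ∈ J₁ i, ∑ j ∈ univ.erase i, δ * ((l j : ℝ) + 1) ≤ Λ := by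
    intro l hl
    have h := (Finset.mem_filter.1 hl).2
    have hfac : ∑ j ∈ univ.erase i, ρ * δ * ((l j : ℝ) + 1) =
        ρ * ∑ j ∈ univ.erase i, δ * ((l j : ℝ) + 1) := by
      rw [Finset.mul_sum]; refine Finset.sum_congr rfl fun j _ => by ring
    rw [hfac] at h
    rw [hΛdef, le_div_iff₀ (by positivity)]
    linarith
  have hS₂ : ∀ l ∈ J₂, Λ ≤ ∑ j ∈ univ.erase i, δ * ((l j : ℝ) + 1) := by
    intro l hl
    have hlJ : l ∈ J := (Finset.mem_filter.1 hl).1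
    have h := (Finset.mem_filter.1 hl).2
    rw [hJ₁, Finset.mem_filter, not_and] at h
    have h' := h hlJ
    push Not at h'
    have hfac : ∑ j ∈ univ.erase i, ρ * δ * ((l j : ℝ) + 1) =
        ρ * ∑ j ∈ univ.erase i, δ * ((l j : ℝ) + 1) := by
      rw [Finset.mul_sum]; refine Finset.sum_congr rfl fun j _ => by ring
    rw [hfac] at h'
    rw [hΛdef, div_le_iff₀ (by positivity)]
    linarith
  have hbound : ∀ S, S ⊆ J → ∀ x ∈ betaBox (n + 1) R i, |marginalSum δ R i S c x| ≤ 2 * B := by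
    intro S hS x hx
    refine abs_marginalSum_le hδ hρ h2R hL hS hJsub i (fun l hl => (hterm l hl i).trans hS₀) hB0 hB
      fun j hj => ?_
    rw [betaBox, Set.mem_univ_pi] at hx
    have := hx j
    rw [if_neg hj] at this
    exact this
  have hsum12 : ∀ x, Ψ₁ x + Ψ₂ x = ΨJ x := fun x => by
    simp only [hΨ₁, hΨ₂, hΨJ, marginalSum, hJ₂]
    rw [← Finset.sum_filter_add_sum_filter_not J (· ∈ J₁ i)]
    congr 1
    rw [Finset.filter_mem_eq_inter, Finset.inter_eq_right.2 (Finset.filter_subset _ _)]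
  set A : Set (Fin (n + 1) → ℝ) := {x | ∑ j ∈ univ.erase i, x j ≤ Λ - 2 * (((n + 1 : ℕ) : ℝ) - 1) * δ} with hA
  set Sh : Set (Fin (n + 1) → ℝ) := {x | Λ - 2 * (((n + 1 : ℕ) : ℝ) - 1) * δ < ∑ j ∈ univ.erase i, x j ∧
    ∑ j ∈ univ.erase i, x j < Λ} with hSh
  have hmsum : Measurable fun x : Fin (n + 1) → ℝ => ∑ j ∈ univ.erase i, x j :=
    Finset.measurable_sum _ fun j _ => measurable_pi_apply j
  have hAm : MeasurableSet A := measurableSet_le hmsum measurable_const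
  have hShm : MeasurableSet Sh :=
    (measurableSet_lt measurable_const hmsum).inter (measurableSet_lt hmsum measurable_const)
  have hpt : ∀ x ∈ betaBox (n + 1) R i,
      A.indicator (fun x => ΨJ x ^ 2) x - Sh.indicator (fun _ => 2 * (2 * B) * (2 * B)) x ≤
        (Ψ₁ x + 2 * Ψ₂ x) * Ψ₁ x := by
    intro x hx
    have h := beta_integrand_lower_bound (R := R) (c := c) hδ hS₁ hS₂ hk2
      (hbound _ (Finset.filter_subset _ _) x hx) (hbound _ (Finset.filter_subset _ _) x hx)
    simp only [Set.indicator_apply, hA, hSh, Set.mem_setOf_eq, ← hsum12 x]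
    convert h using 2
  -- Step 3: integrate over `betaBox`
  have hcont1 : Continuous fun x => (Ψ₁ x + 2 * Ψ₂ x) * Ψ₁ x := by
    simp only [hΨ₁, hΨ₂]
    exact ((marginalSum_continuous _ _ _ _ _).add
      (continuous_const.mul (marginalSum_continuous _ _ _ _ _))).mul (marginalSum_continuous _ _ _ _ _)
  have hcontJ : Continuous fun x => ΨJ x ^ 2 := (marginalSum_continuous _ _ _ _ _).pow 2
  have hvolβ : volume (betaBox (n + 1) R i) < ⊤ :=
    lt_of_le_of_lt (measure_mono (betaBox_subset_Icc hR1 i)) measure_Icc_lt_top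
  have hiA : IntegrableOn (A.indicator fun x => ΨJ x ^ 2) (betaBox (n + 1) R i) :=
    (integrableOn_betaBox_of_continuous hcontJ hR1 i).indicator hAm
  have hiSh : IntegrableOn (Sh.indicator fun _ => 2 * (2 * B) * (2 * B)) (betaBox (n + 1) R i) :=
    (integrableOn_const hvolβ.ne).indicator hShm
  have hint_lower : ∫ x in betaBox (n + 1) R i, (A.indicator (fun x => ΨJ x ^ 2) x -
      Sh.indicator (fun _ => 2 * (2 * B) * (2 * B)) x) ≤
      ∫ x in betaBox (n + 1) R i, (Ψ₁ x + 2 * Ψ₂ x) * Ψ₁ x :=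
    setIntegral_mono_on (hiA.sub hiSh) (integrableOn_betaBox_of_continuous hcont1 hR1 i)
      (measurableSet_betaBox R i) hpt
  have hsplit : ∫ x in betaBox (n + 1) R i, (A.indicator (fun x => ΨJ x ^ 2) x -
      Sh.indicator (fun _ => 2 * (2 * B) * (2 * B)) x) =
      (∫ x in betaBox (n + 1) R i ∩ A, ΨJ x ^ 2) -
        2 * (2 * B) * (2 * B) * (volume (betaBox (n + 1) R i ∩ Sh)).toReal := by
    rw [integral_sub hiA hiSh, setIntegral_indicator hAm, setIntegral_indicator hShm,
      setIntegral_const, smul_eq_mul, measureReal_def, mul_comm]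
  -- Step 4: the shell volume
  obtain ⟨j, hj⟩ := exists_ne_fin hn i
  have hw : (2 : ℝ) * (((n + 1 : ℕ) : ℝ) - 1) * δ = 2 * n * δ := by push_cast; ring
  have hshell : (volume (betaBox (n + 1) R i ∩ Sh)).toReal ≤ 2 * n * δ * R ^ n := by
    have hv := volume_shell_le hR1 i j hj Λ (2 * (((n + 1 : ℕ) : ℝ) - 1) * δ)
    have hv' : volume (betaBox (n + 1) R i ∩ Sh) ≤
        ENNReal.ofReal (2 * (((n + 1 : ℕ) : ℝ) - 1) * δ) * ENNReal.ofReal R ^ n := by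
      rw [Set.inter_comm]; simpa only [hSh] using hv
    have hfin : ENNReal.ofReal (2 * (((n + 1 : ℕ) : ℝ) - 1) * δ) * ENNReal.ofReal R ^ n ≠ ⊤ :=
      ENNReal.mul_ne_top ENNReal.ofReal_ne_top (ENNReal.pow_ne_top ENNReal.ofReal_ne_top)
    have := ENNReal.toReal_mono hfin hv'
    rw [ENNReal.toReal_mul, ENNReal.toReal_pow, ENNReal.toReal_ofReal (by rw [hw]; positivity),
      ENNReal.toReal_ofReal hR0, hw] at this
    exact this
  -- Step 5: `∫_{betaBox ∩ A} ΨJ² ≥ ∫_Q ΨJ²`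
  set Q := betaBox (n + 1) R i ∩ {x | ∑ j ∈ univ.erase i, x j ≤ 1 - ε} with hQ
  have hQm : MeasurableSet Q :=
    (measurableSet_betaBox R i).inter (measurableSet_le hmsum measurable_const)
  have hQsub : Q ⊆ betaBox (n + 1) R i ∩ A := by
    intro x hx
    refine ⟨hx.1, ?_⟩
    simp only [hA, Set.mem_setOf_eq]
    rw [hw]
    exact le_trans hx.2 hΛ
  have hmono : ∫ x in Q, ΨJ x ^ 2 ≤ ∫ x in betaBox (n + 1) R i ∩ A, ΨJ x ^ 2 :=
    setIntegral_mono_set ((integrableOn_betaBox_of_continuous hcontJ hR1 i).mono_set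
      Set.inter_subset_left) (ae_of_all _ fun x => sq_nonneg _) (ae_of_all _ hQsub)
  -- Step 6: the marginal bound on `Q`
  have hFz : ∀ x u, 2 < u → F (Function.update x i u) = 0 := by
    intro x u hu
    by_contra hne
    have hmem := hF.support_subset hne
    have h1 : Function.update x i u i ≤ ∑ j, Function.update x i u j :=
      Finset.single_le_sum (fun j _ => hmem.1 j) (Finset.mem_univ i)
    rw [Function.update_self] at h1
    linarith [hmem.2]
  have hGz : ∀ x u, 2 < u → G (Function.update x i u) = 0 := fun x u hu =>
    tensorSum_update_eq_zero hδ c x i (hS₀.trans hu.le)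
  have hGa : ∀ x, ∫ u in Set.Ioi 0, G (Function.update x i u) = ΨJ x := fun x =>
    setIntegral_Ioi_tensorSum_update hδ hR0 J c i (fun l hl => (hterm l hl i).trans (hS₀.trans h2R)) x
  have hmarg := marginal_sq_bound i h2R hF.measurable (tensorSum_continuous δ J c) hF1
    (integrable_sq_of_isPolymathTestFunction hF) hFz hGz (marginalSum_continuous δ R i J c) hGa
    (Set.inter_subset_left) hQm hτ
  have hJi : polymathJ (n + 1) (1 - ε) i F = ∫ x in Q, (∫ u in Set.Ioi 0, F (Function.update x i u)) ^ 2 :=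
    polymathJ_eq_integral_betaBox hε0.le F hR1 i
  -- Step 7: combine
  have hτ1 : 0 < 1 + τ := by linarith
  have hQge : (polymathJ (n + 1) (1 - ε) i F - (1 + 1 / τ) * (2 * (2 * Δ))) / (1 + τ) ≤ ∫ x in Q, ΨJ x ^ 2 := by
    rw [div_le_iff₀ hτ1, hJi]
    linarith [hmarg]
  have hB2 : 0 ≤ 2 * (2 * B) * (2 * B) := by positivity
  calc (polymathJ (n + 1) (1 - ε) i F - (1 + 1 / τ) * (2 * (2 * Δ))) / (1 + τ) -
        2 * (2 * B) * (2 * B) * (2 * n * δ * R ^ n)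
      ≤ (∫ x in betaBox (n + 1) R i ∩ A, ΨJ x ^ 2) -
          2 * (2 * B) * (2 * B) * (volume (betaBox (n + 1) R i ∩ Sh)).toReal := by
        nlinarith [hQge, hmono, hshell, mul_le_mul_of_nonneg_left hshell hB2]
    _ ≤ ∫ x in betaBox (n + 1) R i, (Ψ₁ x + 2 * Ψ₂ x) * Ψ₁ x := by rw [← hsplit]; exact hint_lower

end AssemblyBeta


/-! ### Assembly, step 3: proof of the `§5.3` analytic fact -/

section Assembly

/-- **Polymath 8b §5.3, analytic step — PROVED.** [cite: Polymath8b2014, Theorem 3.12(i) (proof, §5.3, pp. 21–23)] -/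
theorem exists_tensorCutoffs_of_polymathFunctional_gt_holds :
    exists_tensorCutoffs_of_polymathFunctional_gt := by
  intro k m hk hm ε hε0 hε1 θ hθ0 hθ1 hεθ F hF hM
  obtain ⟨n, rfl⟩ : ∃ n, k = n + 1 := ⟨k - 1, by omega⟩
  have hn : 1 ≤ n := by omega
  classical
  -- the basic quantities `I₀`, `Jsum`
  obtain ⟨I₀, hI₀⟩ : ∃ I₀ : ℝ, I₀ = polymathI (n + 1) F := ⟨_, rfl⟩
  obtain ⟨Jsum, hJsum⟩ : ∃ J : ℝ, J = ∑ i, polymathJ (n + 1) (1 - ε) i F := ⟨_, rfl⟩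
  have hI₀pos : 0 < I₀ := by rw [hI₀]; exact hF.polymathI_pos
  have hratio : 2 * (m : ℝ) / θ < Jsum / I₀ := by
    rw [hJsum, hI₀]; exact hM
  have hmpos : (0 : ℝ) < m := by exact_mod_cast hm
  have hJI : 2 * (m : ℝ) / θ * I₀ < Jsum := (lt_div_iff₀ hI₀pos).1 hratio
  have hJpos : 0 < Jsum := lt_trans (by positivity) hJI
  -- `ρ` strictly between `m I₀ / Jsum` and `θ/2`
  obtain ⟨ρ, hρdef⟩ : ∃ ρ : ℝ, ρ = (m * I₀ / Jsum + θ / 2) / 2 := ⟨_, rfl⟩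
  have hlow : (m : ℝ) * I₀ / Jsum < θ / 2 := by
    rw [div_lt_iff₀ hJpos]
    have h1 := mul_lt_mul_of_pos_left hJI hθ0
    have h2 : θ * (2 * (m : ℝ) / θ * I₀) = 2 * (m * I₀) := by field_simp
    rw [h2] at h1
    linarith only [h1]
  have hρgt : (m : ℝ) * I₀ / Jsum < ρ := by rw [hρdef]; linarith only [hlow]
  have hρlt : ρ < θ / 2 := by rw [hρdef]; linarith only [hlow]
  have hρpos : 0 < ρ := lt_of_le_of_lt (by positivity) hρgt
  have hg : 0 < ρ * Jsum - m * I₀ := by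
    have := (div_lt_iff₀ hJpos).1 hρgt
    linarith only [this]
  obtain ⟨g, hgdef⟩ : ∃ g : ℝ, g = ρ * Jsum - m * I₀ := ⟨_, rfl⟩
  have hgpos : 0 < g := by rw [hgdef]; exact hg
  have h2R : 2 ≤ 1 / ρ := by
    rw [le_div_iff₀ hρpos]; linarith only [hρlt, hθ1]
  have hR1ε : 1 + ε ≤ 1 / ρ := by linarith only [h2R, hε1]
  have hRpos : 0 < 1 / ρ := by positivity
  -- `γ`, `κ`
  obtain ⟨γ, hγdef⟩ : ∃ γ : ℝ, γ = (1 + ε) * θ / 2 - ρ * (1 + ε) := ⟨_, rfl⟩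
  have hγpos : 0 < γ := by
    have h1 : 0 < θ / 2 - ρ := by linarith only [hρlt]
    have h2 : (1 + ε) * θ / 2 - ρ * (1 + ε) = (1 + ε) * (θ / 2 - ρ) := by ring
    rw [hγdef, h2]; positivity
  obtain ⟨κ, hκdef⟩ : ∃ κ : ℝ, κ = min (γ / (4 * ρ)) ((1 - ε) / 4) := ⟨_, rfl⟩
  have hκpos : 0 < κ := by
    rw [hκdef]; exact lt_min (by positivity) (div_pos (by linarith only [hε1]) (by norm_num))
  have hκ1 : ρ * κ ≤ γ / 4 := by
    have : κ ≤ γ / (4 * ρ) := by rw [hκdef]; exact min_le_left _ _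
    calc ρ * κ ≤ ρ * (γ / (4 * ρ)) := mul_le_mul_of_nonneg_left this hρpos.le
      _ = γ / 4 := by field_simp
  have hκ2 : κ ≤ (1 - ε) / 4 := by rw [hκdef]; exact min_le_right _ _
  -- `τ'`, `τ`, `CΔ`, `η`, `w₀`
  obtain ⟨τ', hτ'def⟩ : ∃ t : ℝ, t = g / (5 * m * I₀) := ⟨_, rfl⟩
  have hτ'pos : 0 < τ' := by rw [hτ'def]; positivity
  have hτ'I : m * τ' * I₀ = g / 5 := by rw [hτ'def]; field_simp
  obtain ⟨τ, hτdef⟩ : ∃ t : ℝ, t = g / (5 * ρ * Jsum) := ⟨_, rfl⟩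
  have hτpos : 0 < τ := by rw [hτdef]; positivity
  have hτJ : ρ * Jsum * τ = g / 5 := by rw [hτdef]; field_simp
  obtain ⟨CΔ, hCΔdef⟩ : ∃ C : ℝ, C = m * (1 + 1 / τ') + ρ * (n + 1) * (1 + 1 / τ) * 4 := ⟨_, rfl⟩
  have hCΔpos : 0 < CΔ := by rw [hCΔdef]; positivity
  obtain ⟨η, hηdef⟩ : ∃ e : ℝ, e = g / (20 * CΔ) := ⟨_, rfl⟩
  have hηpos : 0 < η := by rw [hηdef]; positivity
  obtain ⟨w₀, hw₀def⟩ : ∃ w : ℝ, w = min 1 (g / (20 * CΔ * (1 / ρ) ^ (n + 1))) := ⟨_, rfl⟩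
  have hw₀pos : 0 < w₀ := by rw [hw₀def]; exact lt_min one_pos (by positivity)
  have hw₀sq : w₀ ^ 2 * (1 / ρ) ^ (n + 1) ≤ g / (20 * CΔ) := by
    have h1 : w₀ ≤ 1 := by rw [hw₀def]; exact min_le_left _ _
    have h2 : w₀ ≤ g / (20 * CΔ * (1 / ρ) ^ (n + 1)) := by rw [hw₀def]; exact min_le_right _ _
    have hRk : 0 < (1 / ρ) ^ (n + 1) := by positivity
    calc w₀ ^ 2 * (1 / ρ) ^ (n + 1) ≤ w₀ * (1 / ρ) ^ (n + 1) := by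
          refine mul_le_mul_of_nonneg_right ?_ hRk.le
          rw [sq]; exact mul_le_of_le_one_right hw₀pos.le h1
      _ ≤ g / (20 * CΔ * (1 / ρ) ^ (n + 1)) * (1 / ρ) ^ (n + 1) :=
          mul_le_mul_of_nonneg_right h2 hRk.le
      _ = g / (20 * CΔ) := by field_simp
  -- the continuous approximation `Ft`
  obtain ⟨Ft, hFtc, hFts, hFtsum, hdint, hdle⟩ := exists_continuous_sq_approx hF hκpos hηpos
  obtain ⟨B₀, hB₀⟩ := hFtc.bounded_above_of_compact_support hFts
  obtain ⟨B, hBdef⟩ : ∃ B : ℝ, B = max B₀ 0 := ⟨_, rfl⟩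
  have hB0 : 0 ≤ B := by rw [hBdef]; exact le_max_right _ _
  have hB : ∀ x, |Ft x| ≤ B := fun x => by
    rw [hBdef]; exact (le_max_left _ _).trans' (by simpa [Real.norm_eq_abs] using hB₀ x)
  have huc : UniformContinuous Ft := hFts.uniformContinuous_of_continuous hFtc
  obtain ⟨δ₀, hδ₀pos, hδ₀⟩ := Metric.uniformContinuous_iff.1 huc w₀ hw₀pos
  -- `Λ` and `δ`
  obtain ⟨Λ, hΛdef⟩ : ∃ L : ℝ, L = (1 - ε) * θ / (2 * ρ) := ⟨_, rfl⟩
  have hΛgt : 1 - ε < Λ := by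
    rw [hΛdef, lt_div_iff₀ (by positivity)]
    have := mul_lt_mul_of_pos_left (show 2 * ρ < θ by linarith only [hρlt])
      (show (0 : ℝ) < 1 - ε by linarith only [hε1])
    linarith only [this]
  obtain ⟨D₅, hD₅def⟩ : ∃ D : ℝ, D = 16 * ρ * (n + 1) * n * B ^ 2 * (1 / ρ) ^ n + 1 := ⟨_, rfl⟩
  have hD₅pos : 0 < D₅ := by rw [hD₅def]; positivity
  obtain ⟨δ, hδdef⟩ : ∃ d : ℝ, d = min (δ₀ / 2) (min (γ / (4 * ρ * (n + 1)))
    (min ((Λ - (1 - ε)) / (2 * n + 1)) (min ((1 - ε) / (4 * (n + 1))) (g / (5 * D₅))))) := ⟨_, rfl⟩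
  have hδpos : 0 < δ := by
    rw [hδdef]
    refine lt_min (by positivity) (lt_min (by positivity) (lt_min ?_ (lt_min ?_ (by positivity))))
    · exact div_pos (by linarith only [hΛgt]) (by positivity)
    · exact div_pos (by linarith only [hε1]) (by positivity)
  have hδ1 : δ ≤ δ₀ / 2 := by rw [hδdef]; exact min_le_left _ _
  have hδ2 : δ ≤ γ / (4 * ρ * (n + 1)) := by
    rw [hδdef]; exact (min_le_right _ _).trans (min_le_left _ _)
  have hδ3 : δ ≤ (Λ - (1 - ε)) / (2 * n + 1) := by
    rw [hδdef]; exact (min_le_right _ _).trans ((min_le_right _ _).trans (min_le_left _ _))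
  have hδ4 : δ ≤ (1 - ε) / (4 * (n + 1)) := by
    rw [hδdef]
    exact (min_le_right _ _).trans ((min_le_right _ _).trans ((min_le_right _ _).trans (min_le_left _ _)))
  have hδ5 : δ ≤ g / (5 * D₅) := by
    rw [hδdef]
    exact (min_le_right _ _).trans ((min_le_right _ _).trans ((min_le_right _ _).trans (min_le_right _ _)))
  -- consequences
  have hρδ : ρ * ((n : ℝ) + 1) * δ ≤ γ / 4 := by
    have := mul_le_mul_of_nonneg_left hδ2 (by positivity : (0 : ℝ) ≤ ρ * (n + 1))
    calc ρ * ((n : ℝ) + 1) * δ ≤ ρ * (n + 1) * (γ / (4 * ρ * (n + 1))) := this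
      _ = γ / 4 := by field_simp
  have hnδ : 2 * (n : ℝ) * δ ≤ Λ - (1 - ε) := by
    have := (le_div_iff₀ (by positivity : (0 : ℝ) < 2 * n + 1)).1 hδ3
    have e : δ * (2 * (n : ℝ) + 1) = 2 * n * δ + δ := by ring
    rw [e] at this
    linarith only [this, hδpos]
  have hkδ : ((n : ℝ) + 1) * δ ≤ (1 - ε) / 4 := by
    have := (le_div_iff₀ (by positivity : (0 : ℝ) < 4 * (n + 1))).1 hδ4
    have e : δ * (4 * ((n : ℝ) + 1)) = 4 * ((n + 1) * δ) := by ring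
    rw [e] at this
    linarith only [this]
  have hshellδ : D₅ * δ ≤ g / 5 := by
    have := (le_div_iff₀ (by positivity : (0 : ℝ) < 5 * D₅)).1 hδ5
    have e : δ * (5 * D₅) = 5 * (D₅ * δ) := by ring
    rw [e] at this
    linarith only [this]
  -- `L`, `S₀`, the index set and the data
  obtain ⟨L, hLdef⟩ : ∃ L : ℕ, L = ⌈1 / (ρ * δ)⌉₊ := ⟨_, rfl⟩
  have hL : 1 / (ρ * δ) ≤ L := by rw [hLdef]; exact Nat.le_ceil _
  obtain ⟨S₀, hS₀def⟩ : ∃ S : ℝ, S = 1 + ε + κ + (n + 1) * δ := ⟨_, rfl⟩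
  have hS₀2 : S₀ ≤ 2 := by rw [hS₀def]; linarith only [hκ2, hkδ, hε1]
  have hρS₀ : ρ * S₀ < (1 + ε) * θ / 2 := by
    rw [hS₀def]
    have : ρ * (1 + ε + κ + (n + 1) * δ) = ρ * (1 + ε) + ρ * κ + ρ * (n + 1) * δ := by ring
    rw [this]
    linarith only [hκ1, hρδ, hγdef, hγpos]
  set c : (Fin (n + 1) → ℤ) → ℝ := fun l => Ft fun i => δ * l i with hc
  have hcB : ∀ l ∈ goodIndex (n + 1) L δ S₀, |c l| ≤ B := fun l _ => hB _
  -- reduce to the `Finset`-indexed statement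
  refine exists_fin_reindex (goodIndex (n + 1) L δ S₀) c (fun i l => pouCutoff ρ δ l i)
    (fun i l => ρ * δ * ((l i : ℝ) + 1)) m ((1 + ε) * θ / 2) ((1 - ε) * θ / 2) ?_ ?_ ?_
  · intro i l hl
    exact pouCutoff_isSieveCutoff hρpos hδpos l i (by have := nonneg_of_mem_goodIndex hl i; omega)
  · intro l hl
    have hfac : ∑ i, (fun (i : Fin (n + 1)) (l : Fin (n + 1) → ℤ) => ρ * δ * ((l i : ℝ) + 1)) i l =
        ρ * ∑ i, δ * ((l i : ℝ) + 1) := by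
      rw [Finset.mul_sum]; refine Finset.sum_congr rfl fun i _ => by ring
    rw [hfac]
    exact lt_of_le_of_lt (mul_le_mul_of_nonneg_left (sum_le_of_mem_goodIndex hl) hρpos.le) hρS₀
  -- the key inequality
  -- (C) the `L²` error
  have hGquasi : ∀ x : Fin (n + 1) → ℝ, (∀ i, 0 ≤ x i) →
      tensorSum δ (goodIndex (n + 1) L δ S₀) c x = quasiInterp δ L Ft x := fun x hx =>
    tensorSum_goodIndex_eq_quasiInterp hδpos L (fun y hy => by
      have := hFtsum y hy; rw [hS₀def]; push_cast; linarith only [this]) hx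
  have happrox : ∀ x ∈ ioBox (n + 1) (1 / ρ),
      |tensorSum δ (goodIndex (n + 1) L δ S₀) c x - Ft x| ≤ w₀ := by
    intro x hx
    rw [ioBox, Set.mem_univ_pi] at hx
    have hbox : ∀ i, -(L : ℝ) ≤ x i / δ ∧ x i / δ ≤ L := fun i => by
      constructor
      · have : 0 ≤ x i / δ := div_nonneg (hx i).1.le hδpos.le
        linarith only [this, (Nat.cast_nonneg L : (0 : ℝ) ≤ L)]
      · calc x i / δ ≤ (1 / ρ) / δ := div_le_div_of_nonneg_right (hx i).2 hδpos.le
          _ = 1 / (ρ * δ) := by rw [div_div]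
          _ ≤ L := hL
    rw [hGquasi x fun i => (hx i).1.le]
    refine abs_quasiInterp_sub_le hδpos hbox fun y hy => ?_
    have hdist : dist y x < δ₀ := by
      have : dist y x ≤ δ := (dist_pi_le_iff hδpos.le).2 fun i => by
        rw [Real.dist_eq]; exact hy i
      linarith only [this, hδ1, hδ₀pos]
    have := hδ₀ hdist
    rw [Real.dist_eq] at this
    exact this.le
  obtain ⟨hΔint, hΔle⟩ := sq_error_le hRpos.le (tensorSum_continuous δ _ c) hFtc hF.measurable hdint
    happrox hdle
  obtain ⟨Δ, hΔdef⟩ : ∃ D : ℝ, D = ∫ x in ioBox (n + 1) (1 / ρ),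
      (tensorSum δ (goodIndex (n + 1) L δ S₀) c x - F x) ^ 2 := ⟨_, rfl⟩
  rw [← hΔdef] at hΔle
  have hΔ0 : 0 ≤ Δ := by rw [hΔdef]; exact integral_nonneg fun x => sq_nonneg _
  have hΔg : CΔ * Δ ≤ g / 5 := by
    have h1 : Δ ≤ 2 * (g / (20 * CΔ)) + 2 * (g / (20 * CΔ)) := by
      calc Δ ≤ 2 * w₀ ^ 2 * (1 / ρ) ^ (n + 1) + 2 * η := hΔle
        _ ≤ 2 * (g / (20 * CΔ)) + 2 * (g / (20 * CΔ)) := by rw [hηdef]; linarith only [hw₀sq]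
    calc CΔ * Δ ≤ CΔ * (2 * (g / (20 * CΔ)) + 2 * (g / (20 * CΔ))) :=
          mul_le_mul_of_nonneg_left h1 hCΔpos.le
      _ = g / 5 := by field_simp; ring
  -- (A)
  have hA := alpha_le hρpos hδpos (goodIndex (n + 1) L δ S₀) c hF hR1ε hΔint hτ'pos
  rw [← hΔdef, ← hI₀] at hA
  -- (B)
  have hF1 : Integrable F := by
    have hmem : MemLp F 2 volume :=
      (memLp_two_iff_integrable_sq hF.measurable.aestronglyMeasurable).2
        (integrable_sq_of_isPolymathTestFunction hF)
    have hΩ : volume (scaledSimplex (n + 1) (1 + ε)) < ⊤ := by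
      refine lt_of_le_of_lt (measure_mono ?_) (measure_Icc_lt_top (a := (0 : Fin (n + 1) → ℝ))
        (b := fun _ => 1 + ε))
      intro x hx
      refine ⟨fun i => hx.1 i, fun i => ?_⟩
      exact (Finset.single_le_sum (fun j _ => hx.1 j) (Finset.mem_univ i)).trans hx.2
    haveI : IsFiniteMeasure (volume.restrict (scaledSimplex (n + 1) (1 + ε))) :=
      isFiniteMeasure_restrict.2 hΩ.ne
    have hint : IntegrableOn F (scaledSimplex (n + 1) (1 + ε)) :=
      (hmem.restrict _).integrable one_le_two
    exact hint.integrable_of_forall_notMem_eq_zero fun x hx => by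
      by_contra h; exact hx (hF.support_subset h)
  have hΛ' : 1 - ε ≤ (1 - ε) * θ / (2 * ρ) - 2 * n * δ := by rw [← hΛdef]; linarith only [hnδ]
  have hB' : ∀ i : Fin (n + 1), ρ ^ (n + 1 + 1) * ((polymathJ (n + 1) (1 - ε) i F -
      (1 + 1 / τ) * (2 * (2 * Δ))) / (1 + τ) - 2 * (2 * B) * (2 * B) * (2 * n * δ * (1 / ρ) ^ n)) ≤
      tensorBeta (goodIndex (n + 1) L δ S₀) c (fun i l => pouCutoff ρ δ l i)
        (fun i₁ => (goodIndex (n + 1) L δ S₀).filter fun l =>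
          ∑ j ∈ univ.erase i₁, ρ * δ * ((l j : ℝ) + 1) < (1 - ε) * θ / 2) i := by
    intro i
    have h := beta_ge (θ := θ) hε0 hρpos hδpos h2R hL hS₀2 hn hΛ' c hB0 hcB hF hF1
      (by linarith only [hε1]) hτpos i
    rw [← hΔdef] at h
    exact h
  -- summing (B) over `i`
  have hsum_eq : ∑ i : Fin (n + 1), ρ ^ (n + 1 + 1) * ((polymathJ (n + 1) (1 - ε) i F -
      (1 + 1 / τ) * (2 * (2 * Δ))) / (1 + τ) - 2 * (2 * B) * (2 * B) * (2 * n * δ * (1 / ρ) ^ n)) =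
      ρ ^ (n + 1 + 1) * ((Jsum - (n + 1) * ((1 + 1 / τ) * (2 * (2 * Δ)))) / (1 + τ) -
        (n + 1) * (2 * (2 * B) * (2 * B) * (2 * n * δ * (1 / ρ) ^ n))) := by
    rw [← Finset.mul_sum, Finset.sum_sub_distrib, Finset.sum_const, Finset.card_univ,
      Fintype.card_fin, nsmul_eq_mul, ← Finset.sum_div, Finset.sum_sub_distrib, Finset.sum_const,
      Finset.card_univ, Fintype.card_fin, nsmul_eq_mul, ← hJsum]
    push_cast
    ring
  have hsumB : ρ ^ (n + 1 + 1) * ((Jsum - (n + 1) * ((1 + 1 / τ) * (2 * (2 * Δ)))) / (1 + τ) -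
      (n + 1) * (2 * (2 * B) * (2 * B) * (2 * n * δ * (1 / ρ) ^ n))) ≤
      ∑ i₀, tensorBeta (goodIndex (n + 1) L δ S₀) c (fun i l => pouCutoff ρ δ l i)
        (fun i₁ => (goodIndex (n + 1) L δ S₀).filter fun l =>
          ∑ j ∈ univ.erase i₁, ρ * δ * ((l j : ℝ) + 1) < (1 - ε) * θ / 2) i₀ := by
    rw [← hsum_eq]
    exact Finset.sum_le_sum fun i _ => hB' i
  -- final arithmetic
  have hρk : 0 < ρ ^ (n + 1) := pow_pos hρpos _
  have hτ1 : 0 < 1 + τ := by linarith only [hτpos]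
  have hfrac : ρ * Jsum - g / 5 ≤ ρ * Jsum / (1 + τ) := by
    rw [le_div_iff₀ hτ1]
    have e : (ρ * Jsum - g / 5) * (1 + τ) = ρ * Jsum + ρ * Jsum * τ - g / 5 - g / 5 * τ := by ring
    rw [e, hτJ]
    have := mul_pos hgpos hτpos
    linarith only [this]
  have hX0 : 0 ≤ ((n : ℝ) + 1) * ((1 + 1 / τ) * (2 * (2 * Δ))) :=
    mul_nonneg (by positivity) (mul_nonneg (by positivity) (by linarith))
  have hfrac2 : ρ * Jsum - g / 5 - ρ * ((n + 1) * ((1 + 1 / τ) * (2 * (2 * Δ)))) ≤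
      ρ * ((Jsum - (n + 1) * ((1 + 1 / τ) * (2 * (2 * Δ)))) / (1 + τ)) := by
    rw [sub_div, mul_sub]
    have h1 : ρ * ((n + 1) * ((1 + 1 / τ) * (2 * (2 * Δ))) / (1 + τ)) ≤
        ρ * ((n + 1) * ((1 + 1 / τ) * (2 * (2 * Δ)))) := by
      refine mul_le_mul_of_nonneg_left ?_ hρpos.le
      rw [div_le_iff₀ hτ1]
      have := mul_nonneg hX0 hτpos.le
      linarith only [this]
    have h2 : ρ * (Jsum / (1 + τ)) = ρ * Jsum / (1 + τ) := by ring
    linarith only [h1, h2, hfrac]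
  have hshell : ρ * ((n + 1) * (2 * (2 * B) * (2 * B) * (2 * n * δ * (1 / ρ) ^ n))) ≤ g / 5 := by
    have e : ρ * ((n + 1) * (2 * (2 * B) * (2 * B) * (2 * n * δ * (1 / ρ) ^ n))) =
        (16 * ρ * (n + 1) * n * B ^ 2 * (1 / ρ) ^ n) * δ := by ring
    rw [e]
    have hle : (16 * ρ * (n + 1) * n * B ^ 2 * (1 / ρ) ^ n) * δ ≤ D₅ * δ :=
      mul_le_mul_of_nonneg_right (by rw [hD₅def]; linarith only) hδpos.le
    linarith only [hle, hshellδ]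
  have hΔsplit : (m : ℝ) * ((1 + 1 / τ') * Δ) + ρ * ((n + 1) * ((1 + 1 / τ) * (2 * (2 * Δ)))) =
      CΔ * Δ := by
    rw [hCΔdef]; ring
  have hgI : ρ * Jsum - m * I₀ = g := by rw [hgdef]
  have key : (m : ℝ) * ((1 + τ') * I₀ + (1 + 1 / τ') * Δ) <
      ρ * ((Jsum - (n + 1) * ((1 + 1 / τ) * (2 * (2 * Δ)))) / (1 + τ) -
        (n + 1) * (2 * (2 * B) * (2 * B) * (2 * n * δ * (1 / ρ) ^ n))) := by
    have hexp : (m : ℝ) * ((1 + τ') * I₀ + (1 + 1 / τ') * Δ) =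
        m * I₀ + m * τ' * I₀ + m * ((1 + 1 / τ') * Δ) := by ring
    rw [hexp, hτ'I, mul_sub]
    linarith only [hΔg, hfrac2, hshell, hΔsplit, hgI, hgpos]
  calc (m : ℝ) * tensorAlpha (goodIndex (n + 1) L δ S₀) c (fun i l => pouCutoff ρ δ l i)
      ≤ m * (ρ ^ (n + 1) * ((1 + τ') * I₀ + (1 + 1 / τ') * Δ)) :=
        mul_le_mul_of_nonneg_left hA hmpos.le
    _ = ρ ^ (n + 1) * (m * ((1 + τ') * I₀ + (1 + 1 / τ') * Δ)) := by ring
    _ < ρ ^ (n + 1) * (ρ * ((Jsum - (n + 1) * ((1 + 1 / τ) * (2 * (2 * Δ)))) / (1 + τ) -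
        (n + 1) * (2 * (2 * B) * (2 * B) * (2 * n * δ * (1 / ρ) ^ n)))) :=
        mul_lt_mul_of_pos_left key hρk
    _ = ρ ^ (n + 1 + 1) * ((Jsum - (n + 1) * ((1 + 1 / τ) * (2 * (2 * Δ)))) / (1 + τ) -
        (n + 1) * (2 * (2 * B) * (2 * B) * (2 * n * δ * (1 / ρ) ^ n))) := by ring
    _ ≤ _ := hsumB

end Assembly

end Literature.NumberTheory.Sieve
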